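import Literature.MathematicalPhysics.QuantumFieldTheory.Balaban1983to89.Beta.VectorLegVolumeAdapter
import Literature.MathematicalPhysics.QuantumFieldTheory.Balaban1983to89.Beta.HidentScalewise
import Literature.MathematicalPhysics.QuantumFieldTheory.Balaban1983to89.Beta.OddMoments

/-!
# Bałaban's lattice YM₄ RG programme — β-function sub-cell: THE SCALE-WISE ONE-SHOT FORM OF (D1) ON THE VECTOR ROAD
# (lead lineage strat-b12, gen 9; RULINGS (R17)/(R18) of the β sub-cell, typed: the EXIT-B socket)
# VERSIONS: v1 p185521 06534b4c9602 (§1–§3); v1.1 p185693 10d4740f95c6 (APPEND-ONLY): §4 «L-TRANSFER ⊂ (D1)» — RULING (R19): the cumulative L-transfer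
# defect between a base-`Lc` and a base-`Lc^n` construction is bounded by the two (D1) constants (asym1 Q-asym1-5 / R-asym1-3, an2 C-an2-52).
# v1.2 p186248 c246047fb943 (APPEND-ONLY): §5 the PRINTED read-out (1.22) as the socket's `F` — `readout122 μ ν M := M μ ν μ ν`, `readout122_m2Tensor :
# readout122 μ ν (m2Tensor T) = B12Beta.secondMoment T μ ν` — so RULING (R20-3)'s «Fbal := the typed (1.22) read-out» is BY NAME, and END corollaries with
# `hβ : ∀ j, Sβ.β0 j = secondMoment (T j) μ ν` and `D1Rep` in the form `∀ m ≥ 1, |secondMoment (𝒯 m) μ ν − oneShotSide … (Lc^m)| ≤ U`.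
# v1.3 p186415 (APPEND-ONLY + one import `Beta.OddMoments`): §6 (T0)/(T1) FROM THE PRINTED PROPERTIES (5.7)/(5.9)/(5.10) p. 293 as typed by an1
# (`PolarizationSign.AxisReflectionCovariant` / `WardTransversal` / `momentSummable_of_decay510`, `OddMoments.firstMoment_eq_zero_of_reflectionCovariant`,
# `PolarizationSign.tsum_eq_zero_of_ward` BY NAME) and the END corollary `endpointExistence_of_scalewise_vectorSeam_printed`: EXIT-B's kernel-side obligations on
# `Tbal j` are EXACTLY uniform (5.10) decay + (5.7) + (5.9) + `HessianTelescoping` + `D1Rep`.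
# v1.4 p186539 DOCSTRING-ONLY: lit2-g16 XREAD C-lit2g16-1 advisories A1 (this version list) / A2 (§4's p. 251 quotation made verbatim); no declaration changed.
# v1.5 p186611 306188421fd1 (APPEND-ONLY): §7 THE DRIFT EXPOSED — `oneLoopDrift_of_vectorTails_evenVolume` ((D1) full-sum ⟹ `OneLoopDrift (stepBal N Lc) A β⁰`: the one-loop
# coefficients drift about the lattice value `stepBal N Lc` with bounded cumulative error — the chain's buried (AF-0) step, by name) + `oneLoopDrift_of_scalewise_printed`.
# v1.6 p187481 88ac0efb8d5c (APPEND-ONLY): §8 RULINGS (R21)/(R22) — the socket IN THE KERNEL'S CONVENTION (`…_printed_flip`: (5.9)/(5.7) asked of the FLIPPED one-step kernels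
# `fun μ ν z => T j μ ν (−z)`, the form valid for `hessKer`-type families — an2 CONVENTION NOTE / `KernelReflection`) and WITH (D5) = (C) ONLY (`…_cont`: the upper-bound
# binder `BetaUpperH` dropped — derived on the drift road, an4 `DriftRemainder` v1.1 §6); EXIT-B socket v2 = `endpointExistence_of_scalewise_vectorSeam_printed_flip_cont`.
# + (R21) certified (`beta0_eq_zero_of_unflipped_instantiation`), `D1Tel` reduced to second-moment additivity (`hessianTelescoping_iff_m2Tensor_sum`), and §9 THE FREE-BUBBLE
# DRIFT (`oneShotSide_drift`) with `d1Rep_iff_oneLoopDrift`: at END grade (D1) ⟺ «β⁰ drifts with slope stepBal N Lc»; the (α)-leaves enter only through the free-bubble drift.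
# v1.8 (this file, APPEND-ONLY on v1.7 p188492 1f3c29513d78): §11 THE READ-OUT-LEVEL SEAM — `ReadoutSum β0 𝒯 μ ν` (the partial sums of the step coefficients ARE the
# (1.22) read-outs of the one-shot kernels: the ONLY form in which the wall consumes Hessian telescoping), `readoutSum_of_hessianTelescoping` (the v1 socket implies it),
# `hU_of_readoutSum`, `readoutRep_iff_oneLoopDrift` (NO step-kernel data at all: given `ReadoutSum`, the `D1Rep`-form ⟺ the drift), `oneLoopDrift_of_readoutSum_rep`,
# `endpointExistence_of_readoutSum_rep_cont`; answers beta-an4-g16's observation X-an4-38 (the telescoping binder may be cut at the read-out level with NO loss) and lets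
# P6c «LongitudinalCancellation» (RULING (R26-2)) be typed at the weakest sufficient level; header: the literal charter ABSOLUTE RULE sentence (beta-ref A-R371).
# v1.7 p188492: §10 RULING (R24) BY NAME — what the constant `U` of the representation binder absorbs: two references with a common slope differ by a bounded
# amount (`abs_sub_le_of_common_slope`), the free reference bubble at two admissible parameters `a`, `a′` stays within a bounded distance (`oneShotSide_pair_bounded`), the
# `D1Rep`-form is insensitive to `a` (`d1RepForm_iff_of_param`) and, given ANY second one-shot representation, EQUIVALENT to the boundedness of the scheme defect
# (`d1RepForm_iff_defect_bounded`, `d1RepForm_of_reference`) — so a scheme defect (composite vs direct one-shot) is EXIT-A content only on a route through the second scheme.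

HONEST FRAMING (cell rule, verbatim): «discharging `BetaPertH` makes Bałaban's UV stability UNCONDITIONAL — a real constructive-QFT
result; it is NOT the continuum limit and NOT the Clay problem.»  This module formalises NO statement printed in Bałaban's papers and cites
none as a hypothesis; it is [folklore] bookkeeping over two landed roads — an2's SCALE-WISE form of the one-loop binder
(`Beta/HidentScalewise`: read-out `hβ`, (N1-B) `HessianTelescoping`, `flowSum_eq_oneShotReadout`) and an5/an1's VECTOR SEAM
(`Beta/VectorLegVolumeAdapter.endpointExistence_of_vectorTails_evenVolume`: the small-field vector legs = entries of the explicit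
infinite-volume kernel `GfE` (= `K^∞`, `VectorPropagatorLimit.GfE_eq_Kinf`), Γ-part window rows and volume limits DISCHARGED, the two
printed Props `B5.Prop12Printed` / `B5.Kernel126_127Printed` quoted BY NAME).  It DISCHARGES NOTHING of the wall; NOT summit progress.

ABSOLUTE RULE (cell charter, verbatim; literal sentence added v1.8 per beta-ref A-R371): «No internally-minted statement may enter as a cited fact. Every
hypothesis is either kernel-proved in this package or a verbatim quotation of a PUBLISHED theorem with page reference. The manuscript(s) under audit are NOT
citable for their own disputed steps — they are the thing under adjudication; programme-internal (2001/route/tribunal) claims are never citable.»  Nothing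
below is cited: there is no `[cite: …]` tag on any declaration of this file; the two printed Props enter BY NAME as HYPOTHESES (`h12`, `h126`), never as facts.

## What is proved

RULING (R17) (BETA-SPEC §7.35): on the vector road the wall's located analytic content is (D1) in FULL-SUM form
`hU : ∀ m ≥ 1, |Σ_{j<m} β⁰_j − Σ_{b ∈ lblock SL (Lc^m)} uwt_b · fullSum (stK μ ν N (GfE a k (Lc^m) b))| ≤ U`, plus (D4), (D5).
RULING (R18-1): the β sub-cell's EXIT-B («precisely walled, concrete grade») asks for (D1) as closed statements about the GENUINE one-step /
one-shot one-loop Hessian kernels `T j` / `𝒯 m` of the typed U = 1 system once brick (T-def) defines them.  This file provides the socket: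

* `OneShotFullSum Lc F 𝒯 N μ ν a SL k U` (§1) — ONE comparison per scale between the read-out `F (m2Tensor (𝒯 m))` of the one-shot Hessian
  kernel and the base-point-averaged K^∞ full sums at blocking `Lc^m`, error `U` uniform in `m` (the vector-road analogue of an2's
  `OneShotRepresentation`, with NO leg-row binder: the legs are the explicit `GfE`);
* `hU_of_scalewise` (§2): `hβ` + Hessian data + `HessianTelescoping` + `OneShotFullSum` ⟹ the vector road's `hU` at the trivial instance
  (`flowSum_eq_oneShotReadout`: `Σ_{j<m} β⁰_j = F (m2Tensor (𝒯 m))`);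
* `endpointExistence_of_scalewise_vectorSeam` (§3, + `_of_symmetries`): `EndpointExistence Cn` from EXACTLY — the two printed Props BY NAME
  (h12, h126), base-point labels, table/window data, the scale-wise one-loop data (`T`, `𝒯`, `AbsMoment₂` + (T0)/(T1) or divergence-freeness +
  midpoint inversion, additive read-out `F`, `hβ`, `HessianTelescoping`), `OneShotFullSum`, (D4) `RemainderConst` + `rr ≤ stepBal`, (D5)
  `BetaContH` + `BetaUpperH`, structural `ForwardGenerated`.  When (T-def) supplies `T := Tbal`, `𝒯 := 𝒯bal`, `F := Fbal` with `β⁰_j` DEFINED as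
  `Fbal (m2Tensor (Tbal j))` (so `hβ := fun _ => rfl`), the two remaining one-loop hypotheses ARE the closed Props `D1Tel`/`D1Rep` of (R18-1).
* §4 (v1.1, RULING (R19)) `lTransfer_defect_le_of_hU` / `lTransfer_flowSum_le_of_hU` / `lTransfer_oneShot_le` /
  `lTransfer_flowSum_le_of_scalewise`: «L-TRANSFER ⊂ (D1)» — the one-shot side `oneShotSide SL μ ν N a k n` of `hU` depends on the blocking
  scale `n` alone and `(Lc^n)^m = Lc^(n·m)`, so `hU` (resp. `OneShotFullSum`) at base `Lc` and at base `Lc^n` bound the cumulative L-transfer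
  defect `|Σ_{j<n·m} β₁⁰ j − Σ_{j<m} β₂⁰ j|` by `U₁ + U₂` uniformly in `m`; «L-transfer» at existence grade is NOT a new wall item.
* §5 (v1.2, RULING (R20-3)) `readout122` / `readout122_m2Tensor` / `oneShotFullSum_readout122_iff` /
  `endpointExistence_of_scalewise_vectorSeam_readout122[_of_symmetries]`: the read-out `F` of the socket instantiated BY NAME with the PRINTED
  (1.22) second moment `B12Beta.secondMoment` ([Balaban1987RG1] p. 264 (1.22), typed in `B12Beta`): `hβ : ∀ j, Sβ.β0 j = secondMoment (T j) μ ν` and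
  `D1Rep` ≡ `∃ U, ∀ m ≥ 1, |secondMoment (𝒯 m) μ ν − oneShotSide SL μ ν N a k (Lc^m)| ≤ U` — no abstract read-out left in EXIT-B.
* §6 (v1.3) `hasSum_zero_of_ward` / `hasSum_firstMoment_zero_of_reflection` / `absMoment₂_of_decay` / `endpointExistence_of_scalewise_vectorSeam_printed`:
  the socket's (T0)/(T1)/`AbsMoment₂` hypotheses on the one-step kernels DISCHARGED from the PRINTED p. 293 properties as typed by an1 — (5.10) uniform
  exponential decay, (5.9) `WardTransversal`, (5.7) `AxisReflectionCovariant` — BY NAME (`tsum_eq_zero_of_ward`, `firstMoment_eq_zero_of_reflectionCovariant`,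
  `momentSummable_of_decay510`, `absMoment₂_of_decay510`); the END corollary takes `hdec`/`hW`/`hR` per step instead of `hTA`/`hT0`/`hT1`.
* §7 (v1.5) `oneLoopDrift_of_vectorTails_evenVolume` / `oneLoopDrift_of_scalewise_printed`: the DRIFT conclusion of the vector chain exposed by name —
  under h12/h126 and the full-sum binder `hU` (resp. the printed-symmetries data + `D1Rep`), `∃ A, OneLoopDrift (B12Normalization.stepBal N Lc) A β⁰`
  (`|Σ_{j<k} β⁰_j − k · stepBal N Lc| ≤ A` for all k): lattice one-loop asymptotic freedom (AF-0) as the located consequence of (D1), before any (D4)/(D5) input.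
* §8 (v1.6, RULINGS (R21)/(R22)) `decay510_flip` / `hasSum_zero_of_ward_flip` / `hasSum_firstMoment_zero_of_reflection_flip` / `scalewiseData_of_printed_flip` /
  `endpointExistence_of_scalewise_vectorSeam_printed_flip` / `oneLoopDrift_of_scalewise_printed_flip` / `endpointExistence_of_scalewise_vectorSeam_cont` /
  `endpointExistence_of_scalewise_vectorSeam_printed_flip_cont` / `…_printed_cont`: (R21) an1's `WardTransversal`/`AxisReflectionCovariant` are typed in the
  PRINT's variable `z = x − y` while `hessKer`-type kernels (an2's `TOf`) are read at `−z`, so for such families the printed laws are asked of the FLIPPED kernels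
  `fun μ ν z => T j μ ν (−z)` — (T0)/(T1)/`AbsMoment₂`/(5.10)/(1.22) being flip-insensitive, the END follows verbatim; (R22) the `_cont` ENDs drop `hup`/`hβ'`
  ((D5) = (C) `BetaContH` only: the printed-type upper bound is `stepBal + 2A + rr` on the drift road, an4's `endpointExistence_of_drift_remainderConst_cont`).
  Also `hessianTelescoping_iff_m2Tensor_sum[_of_printed_flip]`: under the socket's per-step data `D1Tel` IS second-moment-tensor additivity
  `m2Tensor (𝒯 m) = Σ_{j<m} m2Tensor (T j)` (checklist item (iii) reduced; `coarseTensor_minimiser`).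
  And (R21) CERTIFIED: `offDiag_eq_zero_of_both_reflection_laws` / `secondMoment_eq_zero_of_both_reflection_laws` / `beta0_eq_zero_of_unflipped_instantiation`
  — a summable kernel obeying the reflection law (5.7) in BOTH conventions has vanishing off-diagonal channels, so an unflipped instantiation of `…_printed` at a
  `hessKer`-family forces `β⁰ ≡ 0` through `hβ`.
* §9 (v1.6) `splitOf` / `oneShotSide_drift` / `d1Rep_iff_oneLoopDrift` / `endpointExistence_of_oneLoopDrift`: the chain's free-field content isolated — the FREE one-shot
  bubble `oneShotSide … (Lc^n)` grows like `n · stepBal N Lc` up to a bounded error (inputs: h12/h126 by name, labels, window data; NO β-family); hence, given the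
  scale-wise data, `D1Rep ⟺ ∃ A, OneLoopDrift (stepBal N Lc) A β⁰`, and the END follows from the drift + (D4) + (C) with no legs (an4's `_cont` END re-exported).
* §10 (v1.7, RULING (R24)) `abs_sub_le_of_common_slope` / `oneShotSide_pair_bounded` / `d1RepForm_iff_defect_bounded` / `d1RepForm_of_reference` /
  `d1RepForm_iff_of_param`: WHAT `U` ABSORBS — anything bounded uniformly in the scale.  The free reference bubble `oneShotSide … a … (Lc^n)` at two admissible
  parameters `a`, `a′` (h12 at both) differs by a bounded amount, so the `D1Rep`-form `∃ U, ∀ m ≥ 1, |secondMoment (𝒯 m) μ ν − oneShotSide … (Lc^m)| ≤ U` does not depend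
  on `a`; and given ANY second one-shot family `𝒯′` with its own representation, the `D1Rep`-form for `𝒯` is EQUIVALENT to `∃ B, ∀ m ≥ 1, |secondMoment (𝒯 m) μ ν −
  secondMoment (𝒯′ m) μ ν| ≤ B` — a scheme defect (e.g. Bałaban's composite `Lc`-steps vs the direct `Lc^m`-average, an2's `γ_m`) is wall content only on a proof route
  THROUGH the second scheme; the wall's statement (`D1Drift`, RULING (R23)) is route-free.
* §11 (v1.8, THE READ-OUT-LEVEL SEAM; beta-an4 X-an4-38 / RULING (R26-2)) `ReadoutSum β0 𝒯 μ ν := ∀ m ≥ 1, Σ_{j<m} β0 j = secondMoment (𝒯 m) μ ν` — the partial sums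
  of the step coefficients ARE the (1.22) read-outs of the one-shot kernels.  This is the ONLY consequence of `HessianTelescoping` the wall uses
  (`readoutSum_of_hessianTelescoping`: the v1 data (hTA, (T0), (T1), `hβ`, `HessianTelescoping`) imply it, via `HidentScalewise.flowSum_eq_oneShotReadout`), and from it
  ALONE — no step kernels `T`, no Ward data, no undressing — `hU_of_readoutSum`, **`readoutRep_iff_oneLoopDrift`** (given `ReadoutSum`, the `D1Rep`-form
  `∃ U, ∀ m ≥ 1, |secondMoment (𝒯 m) μ ν − oneShotSide … (Lc^m)| ≤ U` ⟺ `∃ A, OneLoopDrift (stepBal N Lc) A β0`, by the free-bubble drift of §9),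
  `oneLoopDrift_of_readoutSum_rep` and the END form `endpointExistence_of_readoutSum_rep_cont` ((D4) constant form + (C) only).  So a proof route may deliver the
  telescoping AT THE READ-OUT LEVEL (one additive functional, `readout122 μ ν`) with NO loss at the wall — the level at which RULING (R26-2)'s support item P6c
  «LongitudinalCancellation» is weakest; the v1–v1.7 sockets through `HessianTelescoping` remain, as the special case.

## No free lunch (RULING (R16-1), beta-ref C-beta-167 / A-R290)

`(T, F, hβ)` are inhabited for EVERY `β⁰` (dipole kernel); at such a witness `HessianTelescoping` forces `F (m2Tensor (𝒯 m)) = Σ_{j<m} β⁰_j`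
and `OneShotFullSum` IS `hU` again (`oneShotFullSum_iff_hU_of_telescoping`).  Content arises only for the GENUINE kernels of (T-def).

## READING CLAUSE ((W-KKT-2), as in `HidentScalewise` / `ComposedRoadFromSpec`)

`wK`, `T j`, `𝒯 m` refer to the TYPED U = 1 block-averaging KKT system (`KernelSpecInstance.specK`); their identification with Bałaban's
gauge-fixed minimiser and one-loop Hessians ([Balaban1984PropagatorsI] p. 26 (1.48)–(1.49); [Balaban1985BackgroundPropagators] p. 417
(3.109)–(3.110) at U = 1; [Balaban1987RG1] p. 264 (1.20)–(1.22)) is the sub-cell's READING DICT-KKT — a dictionary, never a hypothesis,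
never cited.  Context only: [Balaban1987RG1] = T. Bałaban, Commun. Math. Phys. 109 (1987) 249–301, Theorem 2 p. 259.
-/

noncomputable section

open Filter Topology Finset
open scoped BigOperators

namespace Literature.MathematicalPhysics.QuantumFieldTheory.Balaban1983to89.Beta.ScalewiseVectorSeam

open Literature.MathematicalPhysics.QuantumFieldTheory.Balaban1983to89
open FlowStep FlowStepRuns DagBinding
open Literature.MathematicalPhysics.QuantumFieldTheory.Balaban1983to89.Beta.DyadicShell (Pt)
open Literature.MathematicalPhysics.QuantumFieldTheory.Balaban1983to89.Beta.VectorTailsLoc (fam kfam)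
open Literature.MathematicalPhysics.QuantumFieldTheory.Balaban1983to89.Beta.VectorTailsBlock (lblock)
open Literature.MathematicalPhysics.QuantumFieldTheory.Balaban1983to89.Beta.VectorTailsSeam (uwt)
open Literature.MathematicalPhysics.QuantumFieldTheory.Balaban1983to89.Beta.MarginalTelescoping (composedCoeff IdentityForm)
open Literature.MathematicalPhysics.QuantumFieldTheory.Balaban1983to89.Beta.RemainderChain (RemainderConst)
open Literature.MathematicalPhysics.QuantumFieldTheory.Balaban1983to89.Beta.WindowIdentification (fullSum)
open Literature.MathematicalPhysics.QuantumFieldTheory.Balaban1983to89.Beta.SquareTable (stK)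
open Literature.MathematicalPhysics.QuantumFieldTheory.Balaban1983to89.Beta.DecimatedMomentSummable (AbsMoment₂)
open Literature.MathematicalPhysics.QuantumFieldTheory.Balaban1983to89.Beta.DressedMomentNormalisation (EKer coarseTensor m2Tensor)
open Literature.MathematicalPhysics.QuantumFieldTheory.Balaban1983to89.Beta.HidentScalewise (Tensor4 HessianTelescoping
  composedCoeff_trivial identityForm_trivial flowSum_eq_oneShotReadout flowSum_eq_oneShotReadout_of_symmetries)
open Literature.MathematicalPhysics.QuantumFieldTheory.Balaban1983to89.Beta.VectorLegVolumeAdapter (MvE GfE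
  endpointExistence_of_vectorTails_evenVolume)

variable {L : Type*}

/-! ## §1 The one-shot full-sum comparison (the vector-road analogue of `OneShotRepresentation`) -/

/-- (I2-rep) ON THE VECTOR ROAD — **ONE-SHOT FULL-SUM COMPARISON**: one comparison per scale between the read-out `F` of the one-shot
Hessian kernel `𝒯 m` and the base-point-averaged full sums of the realised stencil table fed by the EXPLICIT infinite-volume vector
kernel `GfE a k (Lc^m) b` (= `K^∞` entries), error `U` uniform in `m`.  No leg-row binder.  A predicate, never a fact. [folklore] -/
def OneShotFullSum (Lc : ℕ) (F : Tensor4 → ℝ) (𝒯 : ℕ → EKer 4) (N : ℝ) (μ ν : Fin 4) (a : ℝ) (SL : Finset L) (k : L → Fin 4)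
    (U : ℝ) : Prop :=
  ∀ m : ℕ, 1 ≤ m →
    |F (m2Tensor (𝒯 m)) - ∑ b ∈ lblock SL (Lc ^ m), uwt SL (Lc ^ m) b * fullSum (stK μ ν N (GfE a k (Lc ^ m) b))| ≤ U

/-! ## §2 The vector road's `hU` from the scale-wise data -/

/-- **`hU` FROM THE SCALE-WISE FORM** (trivial instance `μC := fun j _ => β⁰ j`): read-out `hβ` + Hessian data + (N1-B) + `OneShotFullSum`
⟹ the full-sum comparison on the partial sums `Σ_{j<m} β⁰_j`. [folklore] -/
theorem hU_of_scalewise {Lc : ℕ} [NeZero Lc] {T 𝒯 : ℕ → EKer 4}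
    (hTA : ∀ j c e, AbsMoment₂ (T j c e)) (hT0 : ∀ j c e, HasSum (T j c e) 0)
    (hT1 : ∀ j c e (ρ : Fin 4), HasSum (fun t : Fin 4 → ℤ => t ρ • T j c e t) 0)
    (htel : HessianTelescoping Lc T 𝒯) {F : Tensor4 → ℝ} (hFadd : ∀ A B, F (A + B) = F A + F B)
    {β0 : ℕ → ℝ} (hβ : ∀ j, β0 j = F (m2Tensor (T j)))
    {N : ℝ} {μ ν : Fin 4} {a : ℝ} {SL : Finset L} {k : L → Fin 4} {U : ℝ}
    (hrep : OneShotFullSum Lc F 𝒯 N μ ν a SL k U) :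
    ∀ m : ℕ, 1 ≤ m →
      |composedCoeff (fun j _ => β0 j) m -
          ∑ b ∈ lblock SL (Lc ^ m), uwt SL (Lc ^ m) b * fullSum (stK μ ν N (GfE a k (Lc ^ m) b))| ≤ U := by
  intro m hm
  rw [composedCoeff_trivial, flowSum_eq_oneShotReadout hTA hT0 hT1 htel hFadd hβ hm]
  exact hrep m hm

/-- … the same with (T0)/(T1) from divergence-freeness + midpoint inversion of the Hessian kernels. [folklore] -/
theorem hU_of_scalewise_of_symmetries {Lc : ℕ} [NeZero Lc] {T 𝒯 : ℕ → EKer 4}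
    (hTA : ∀ j c e, AbsMoment₂ (T j c e))
    (hdiv : ∀ j (ν' : Fin 4) (x : Fin 4 → ℤ), ∑ μ', (T j μ' ν' x - T j μ' ν' (x - Pi.single μ' 1)) = 0)
    (hinv : ∀ j (μ' ν' : Fin 4) (y : Fin 4 → ℤ), T j μ' ν' ((Pi.single ν' 1 - Pi.single μ' 1) - y) = T j μ' ν' y)
    (htel : HessianTelescoping Lc T 𝒯) {F : Tensor4 → ℝ} (hFadd : ∀ A B, F (A + B) = F A + F B)
    {β0 : ℕ → ℝ} (hβ : ∀ j, β0 j = F (m2Tensor (T j)))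
    {N : ℝ} {μ ν : Fin 4} {a : ℝ} {SL : Finset L} {k : L → Fin 4} {U : ℝ}
    (hrep : OneShotFullSum Lc F 𝒯 N μ ν a SL k U) :
    ∀ m : ℕ, 1 ≤ m →
      |composedCoeff (fun j _ => β0 j) m -
          ∑ b ∈ lblock SL (Lc ^ m), uwt SL (Lc ^ m) b * fullSum (stK μ ν N (GfE a k (Lc ^ m) b))| ≤ U := by
  intro m hm
  rw [composedCoeff_trivial, flowSum_eq_oneShotReadout_of_symmetries hTA hdiv hinv htel hFadd hβ hm]
  exact hrep m hm

/-- **NO FREE LUNCH**: under `hβ` + Hessian data + (N1-B), `OneShotFullSum` is EQUIVALENT to the vector road's `hU` on the partial sums —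
so at a dipole witness of `(T, F, hβ)` it carries exactly the content of (D1), no less and no more. [folklore] -/
theorem oneShotFullSum_iff_hU_of_telescoping {Lc : ℕ} [NeZero Lc] {T 𝒯 : ℕ → EKer 4}
    (hTA : ∀ j c e, AbsMoment₂ (T j c e)) (hT0 : ∀ j c e, HasSum (T j c e) 0)
    (hT1 : ∀ j c e (ρ : Fin 4), HasSum (fun t : Fin 4 → ℤ => t ρ • T j c e t) 0)
    (htel : HessianTelescoping Lc T 𝒯) {F : Tensor4 → ℝ} (hFadd : ∀ A B, F (A + B) = F A + F B)
    {β0 : ℕ → ℝ} (hβ : ∀ j, β0 j = F (m2Tensor (T j)))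
    {N : ℝ} {μ ν : Fin 4} {a : ℝ} {SL : Finset L} {k : L → Fin 4} {U : ℝ} :
    OneShotFullSum Lc F 𝒯 N μ ν a SL k U ↔
      ∀ m : ℕ, 1 ≤ m →
        |∑ j ∈ range m, β0 j -
            ∑ b ∈ lblock SL (Lc ^ m), uwt SL (Lc ^ m) b * fullSum (stK μ ν N (GfE a k (Lc ^ m) b))| ≤ U := by
  refine ⟨fun h m hm => ?_, fun h m hm => ?_⟩
  · rw [flowSum_eq_oneShotReadout hTA hT0 hT1 htel hFadd hβ hm]; exact h m hm
  · rw [← flowSum_eq_oneShotReadout hTA hT0 hT1 htel hFadd hβ hm]; exact h m hm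

/-! ## §3 The END statement on the vector road from the scale-wise data (the EXIT-B socket of RULING (R18-1)) -/

/-- **THE WALL (END STATEMENT) ON THE VECTOR ROAD FROM THE SCALE-WISE ONE-SHOT FORM.**  `EndpointExistence Cn` from EXACTLY: the two
printed Props BY NAME (`h12`, `h126` — (α)-leaves, printed with proof), base-point labels `hSL`/`k`, table/window data, the scale-wise
one-loop data of an2's `HidentScalewise` (`T`, `𝒯`, `AbsMoment₂`, (T0)/(T1), additive `F`, `hβ`, (N1-B) `HessianTelescoping`), the ONE-SHOT
FULL-SUM comparison `OneShotFullSum` (= (D1) in its EXIT-B type), (D4) `RemainderConst` + `rr ≤ stepBal N Lc`, (D5) `BetaContH` + `BetaUpperH`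
(`β′ ≥ 0`), structural `ForwardGenerated`.  NO Γ-part row, NO volume-limit binder, NO leg-row binder (RULING (R17)).  Proof: an5-g9's
`endpointExistence_of_vectorTails_evenVolume` at `μC := fun j _ => Sβ.β0 j`, `hid := rfl`, `hU := hU_of_scalewise`.  Subject to the
READING CLAUSE of the header; discharges NOTHING for Bałaban's objects. [folklore] -/
theorem endpointExistence_of_scalewise_vectorSeam (a : ℝ) (ha : 0 < a)
    (h12 : B5.Prop12Printed (fam (fun i : ℕ+ × ℕ => ((i.1 : ℕ+) : ℕ)) (fun i => i.1.pos) MvE a ha))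
    (h126 : B5.Kernel126_127Printed (kfam (fun i : ℕ+ × ℕ => ((i.1 : ℕ+) : ℕ)) MvE))
    {SL : Finset L} (hSL : SL.Nonempty) (k : L → Fin 4) {μ ν : Fin 4}
    {β : HBeta} {Cn : B12.Construction} (hgen : ForwardGenerated Cn β)
    (Sβ : B12Beta.OneLoopSplit β) (hμν : μ ≠ ν) {N : ℝ} (hN : N ≠ 0) {Lc : ℕ} [NeZero Lc] (hL : 2 ≤ Lc)
    -- the scale-wise one-loop data (an2 `HidentScalewise`)
    (T 𝒯 : ℕ → EKer 4) (hTA : ∀ j c e, AbsMoment₂ (T j c e)) (hT0 : ∀ j c e, HasSum (T j c e) 0)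
    (hT1 : ∀ j c e (ρ : Fin 4), HasSum (fun t : Fin 4 → ℤ => t ρ • T j c e t) 0)
    (F : Tensor4 → ℝ) (hFadd : ∀ A B, F (A + B) = F A + F B) (hβ : ∀ j, Sβ.β0 j = F (m2Tensor (T j)))
    (htel : HessianTelescoping Lc T 𝒯)
    -- window data of the vector seam
    {U cc : ℝ} {M : ℕ → ℕ}
    (hc : 1 ≤ cc) (hM : ∀ L : ℕ, 2 ≤ L → 1 ≤ M L ∧ (L : ℝ) ≤ cc * M L) (hML : ∀ L : ℕ, 2 ≤ L → M L ≤ L)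
    -- (D1) in EXIT-B type: ONE full-sum comparison per scale for the one-shot Hessian kernel against the K^∞ legs
    (hrep : OneShotFullSum Lc F 𝒯 N μ ν a SL k U)
    {rr γ₀ β' : ℝ} (hγ₀ : 0 < γ₀) (hrem : RemainderConst Sβ γ₀ rr) (hr : rr ≤ B12Normalization.stepBal N Lc)
    (hβ' : 0 ≤ β') (hcont : BetaContH γ₀ β) (hup : BetaUpperH β' γ₀ β) : EndpointExistence Cn :=
  endpointExistence_of_vectorTails_evenVolume a ha h12 h126 hSL k hgen Sβ hμν hN hL (μC := fun j _ => Sβ.β0 j) hc hM hML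
    (hU_of_scalewise hTA hT0 hT1 htel hFadd hβ hrep) (identityForm_trivial Sβ.β0) hγ₀ hrem hr hβ' hcont hup

/-- **… with (T0)/(T1) from divergence-freeness + midpoint inversion** of the Hessian kernels. [folklore] -/
theorem endpointExistence_of_scalewise_vectorSeam_of_symmetries (a : ℝ) (ha : 0 < a)
    (h12 : B5.Prop12Printed (fam (fun i : ℕ+ × ℕ => ((i.1 : ℕ+) : ℕ)) (fun i => i.1.pos) MvE a ha))
    (h126 : B5.Kernel126_127Printed (kfam (fun i : ℕ+ × ℕ => ((i.1 : ℕ+) : ℕ)) MvE))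
    {SL : Finset L} (hSL : SL.Nonempty) (k : L → Fin 4) {μ ν : Fin 4}
    {β : HBeta} {Cn : B12.Construction} (hgen : ForwardGenerated Cn β)
    (Sβ : B12Beta.OneLoopSplit β) (hμν : μ ≠ ν) {N : ℝ} (hN : N ≠ 0) {Lc : ℕ} [NeZero Lc] (hL : 2 ≤ Lc)
    (T 𝒯 : ℕ → EKer 4) (hTA : ∀ j c e, AbsMoment₂ (T j c e))
    (hdiv : ∀ j (ν' : Fin 4) (x : Fin 4 → ℤ), ∑ μ', (T j μ' ν' x - T j μ' ν' (x - Pi.single μ' 1)) = 0)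
    (hinv : ∀ j (μ' ν' : Fin 4) (y : Fin 4 → ℤ), T j μ' ν' ((Pi.single ν' 1 - Pi.single μ' 1) - y) = T j μ' ν' y)
    (F : Tensor4 → ℝ) (hFadd : ∀ A B, F (A + B) = F A + F B) (hβ : ∀ j, Sβ.β0 j = F (m2Tensor (T j)))
    (htel : HessianTelescoping Lc T 𝒯)
    {U cc : ℝ} {M : ℕ → ℕ}
    (hc : 1 ≤ cc) (hM : ∀ L : ℕ, 2 ≤ L → 1 ≤ M L ∧ (L : ℝ) ≤ cc * M L) (hML : ∀ L : ℕ, 2 ≤ L → M L ≤ L)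
    (hrep : OneShotFullSum Lc F 𝒯 N μ ν a SL k U)
    {rr γ₀ β' : ℝ} (hγ₀ : 0 < γ₀) (hrem : RemainderConst Sβ γ₀ rr) (hr : rr ≤ B12Normalization.stepBal N Lc)
    (hβ' : 0 ≤ β') (hcont : BetaContH γ₀ β) (hup : BetaUpperH β' γ₀ β) : EndpointExistence Cn :=
  endpointExistence_of_vectorTails_evenVolume a ha h12 h126 hSL k hgen Sβ hμν hN hL (μC := fun j _ => Sβ.β0 j) hc hM hML
    (hU_of_scalewise_of_symmetries hTA hdiv hinv htel hFadd hβ hrep) (identityForm_trivial Sβ.β0) hγ₀ hrem hr hβ' hcont hup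

/-! ## §4 L-TRANSFER ⊂ (D1) — RULING (R19) (asym1 Q-asym1-5 / R-asym1-3 «L-transfer»; an2 ANSWER C-an2-52)

B12 Theorem 2 is printed for «L is an odd, positive integer > 11» (p. 251, verbatim) while every engine value of the cell lives at L ∈ {2, 3, 4}; asym1 asked
whether the composed one-loop coefficients at block size `Lc` transfer to those at `Lc^n` (`Σ_{i<n} β⁰_{nk+i}(Lc)` vs `β⁰_k(Lc^n)`), an2 located
the defect `γ_k` (third-order data of the group average; composed-average vs one-shot scheme).  AT EXISTENCE GRADE THIS IS NOT A NEW WALL ITEM: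
the one-shot side of the full-sum binder `hU` (RULING (R17)) is a FUNCTION OF THE BLOCKING SCALE ALONE — the explicit `K^∞` legs `GfE a k n b`
— and `(Lc^n)^m = Lc^(n·m)`, so `hU` for the base-`Lc` coefficients (constant `U₁`) and `hU` for the base-`Lc^n` coefficients (constant `U₂`)
bound the cumulative L-transfer defect by `U₁ + U₂`, uniformly in the number of steps.  The NUMBER `γ₁` with a certified margin that a
finite-`k₁` margin plan needs is a certificate of the acceleration lanes, not a binder of the wall.  Nothing printed is asserted. -/

section LTransfer

/-- The ONE-SHOT SIDE of the full-sum binder `hU` (RULING (R17)) as a function of the blocking scale `n` alone: the base-point-averaged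
full sums of the realised stencil table on the explicit infinite-volume vector kernel `GfE a k n b`. [folklore] -/
def oneShotSide (SL : Finset L) (μ ν : Fin 4) (N a : ℝ) (k : L → Fin 4) (n : ℕ) : ℝ :=
  ∑ b ∈ lblock SL n, uwt SL n b * fullSum (stK μ ν N (GfE a k n b))

/-- `OneShotFullSum` is the statement that the read-outs of the one-shot kernels stay within `U` of `oneShotSide` at the scales `Lc^m`
(definitional unfolding). [folklore] -/
theorem oneShotFullSum_iff_oneShotSide {Lc : ℕ} {F : Tensor4 → ℝ} {𝒯 : ℕ → EKer 4} {N : ℝ} {μ ν : Fin 4} {a : ℝ} {SL : Finset L}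
    {k : L → Fin 4} {U : ℝ} :
    OneShotFullSum Lc F 𝒯 N μ ν a SL k U ↔ ∀ m : ℕ, 1 ≤ m → |F (m2Tensor (𝒯 m)) - oneShotSide SL μ ν N a k (Lc ^ m)| ≤ U :=
  Iff.rfl

/-- Elementary: two quantities within `U₁`, `U₂` of the same reference are within `U₁ + U₂` of each other. [folklore] -/
private theorem abs_sub_le_of_common_ref {x y r U₁ U₂ : ℝ} (h₁ : |x - r| ≤ U₁) (h₂ : |y - r| ≤ U₂) : |x - y| ≤ U₁ + U₂ := by
  have h : x - y = (x - r) - (y - r) := by ring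
  rw [h]
  exact (abs_sub _ _).trans (add_le_add h₁ h₂)

/-- Elementary: `1 ≤ n`, `1 ≤ m` ⟹ `1 ≤ n·m`. [folklore] -/
private theorem one_le_mul_of_one_le {n m : ℕ} (hn : 1 ≤ n) (hm : 1 ≤ m) : 1 ≤ n * m := Nat.mul_pos hn hm

/-- **L-TRANSFER ⊂ (D1), full-sum form** (RULING (R19)).  The full-sum binder `hU` for the composed one-loop coefficients `μC₁` of a
base-`Lc` construction (constant `U₁`) and for `μC₂` of a base-`Lc^n` construction (constant `U₂`) bound the cumulative L-transfer defect
between `n·m` steps at `Lc` and `m` steps at `Lc^n` by `U₁ + U₂`, uniformly in `m ≥ 1`. [folklore] -/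
theorem lTransfer_defect_le_of_hU {SL : Finset L} {μ ν : Fin 4} {N a : ℝ} {k : L → Fin 4} {Lc n : ℕ}
    {μC₁ μC₂ : ℕ → ℕ → ℝ} {U₁ U₂ : ℝ}
    (hU₁ : ∀ m : ℕ, 1 ≤ m → |composedCoeff μC₁ m - oneShotSide SL μ ν N a k (Lc ^ m)| ≤ U₁)
    (hU₂ : ∀ m : ℕ, 1 ≤ m → |composedCoeff μC₂ m - oneShotSide SL μ ν N a k ((Lc ^ n) ^ m)| ≤ U₂)
    (hn : 1 ≤ n) :
    ∀ m : ℕ, 1 ≤ m → |composedCoeff μC₁ (n * m) - composedCoeff μC₂ m| ≤ U₁ + U₂ := by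
  intro m hm
  have h₂ := hU₂ m hm
  rw [← pow_mul] at h₂
  exact abs_sub_le_of_common_ref (hU₁ (n * m) (one_le_mul_of_one_le hn hm)) h₂

/-- **L-TRANSFER ⊂ (D1), trivial instance** — the form the wall uses (`μC := fun j _ => β⁰ j`, RULING (R16-1)): for the one-loop
coefficient sequences `β₁⁰` (base `Lc`) and `β₂⁰` (base `Lc^n`),
`|Σ_{j < n·m} β₁⁰ j − Σ_{j < m} β₂⁰ j| ≤ U₁ + U₂` for every `m ≥ 1`. [folklore] -/
theorem lTransfer_flowSum_le_of_hU {SL : Finset L} {μ ν : Fin 4} {N a : ℝ} {k : L → Fin 4} {Lc n : ℕ}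
    {β₁ β₂ : ℕ → ℝ} {U₁ U₂ : ℝ}
    (hU₁ : ∀ m : ℕ, 1 ≤ m → |∑ j ∈ range m, β₁ j - oneShotSide SL μ ν N a k (Lc ^ m)| ≤ U₁)
    (hU₂ : ∀ m : ℕ, 1 ≤ m → |∑ j ∈ range m, β₂ j - oneShotSide SL μ ν N a k ((Lc ^ n) ^ m)| ≤ U₂)
    (hn : 1 ≤ n) :
    ∀ m : ℕ, 1 ≤ m → |∑ j ∈ range (n * m), β₁ j - ∑ j ∈ range m, β₂ j| ≤ U₁ + U₂ := by
  simpa only [composedCoeff_trivial] using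
    lTransfer_defect_le_of_hU (μC₁ := fun j _ => β₁ j) (μC₂ := fun j _ => β₂ j)
      (by simpa only [composedCoeff_trivial] using hU₁) (by simpa only [composedCoeff_trivial] using hU₂) hn

/-- **L-TRANSFER ⊂ (D1), EXIT-B type** (RULING (R18-1)): two `OneShotFullSum` statements with the SAME read-out `F` and legs, for one-shot
kernels `𝒯₁` at base `Lc` and `𝒯₂` at base `Lc^n`, bound the difference of the one-shot read-outs `F (m2Tensor (𝒯₁ (n·m)))` and
`F (m2Tensor (𝒯₂ m))` by `U₁ + U₂`. [folklore] -/
theorem lTransfer_oneShot_le {Lc n : ℕ} {F : Tensor4 → ℝ} {𝒯₁ 𝒯₂ : ℕ → EKer 4} {N : ℝ} {μ ν : Fin 4} {a : ℝ} {SL : Finset L}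
    {k : L → Fin 4} {U₁ U₂ : ℝ}
    (h₁ : OneShotFullSum Lc F 𝒯₁ N μ ν a SL k U₁) (h₂ : OneShotFullSum (Lc ^ n) F 𝒯₂ N μ ν a SL k U₂) (hn : 1 ≤ n) :
    ∀ m : ℕ, 1 ≤ m → |F (m2Tensor (𝒯₁ (n * m))) - F (m2Tensor (𝒯₂ m))| ≤ U₁ + U₂ := by
  intro m hm
  have e₂ := (oneShotFullSum_iff_oneShotSide.mp h₂) m hm
  rw [← pow_mul] at e₂
  exact abs_sub_le_of_common_ref ((oneShotFullSum_iff_oneShotSide.mp h₁) (n * m) (one_le_mul_of_one_le hn hm)) e₂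

/-- **… and at the trivial instance through the telescoping** (`flowSum_eq_oneShotReadout`): with Hessian data, (N1-B) and the read-outs
`hβ₁`, `hβ₂` on both sides, the two `OneShotFullSum` statements bound `|Σ_{j<n·m} β₁⁰ j − Σ_{j<m} β₂⁰ j|` by `U₁ + U₂`. [folklore] -/
theorem lTransfer_flowSum_le_of_scalewise {Lc n : ℕ} [NeZero Lc] [NeZero (Lc ^ n)]
    {T₁ 𝒯₁ T₂ 𝒯₂ : ℕ → EKer 4}
    (hTA₁ : ∀ j c e, AbsMoment₂ (T₁ j c e)) (hT0₁ : ∀ j c e, HasSum (T₁ j c e) 0)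
    (hT1₁ : ∀ j c e (ρ : Fin 4), HasSum (fun t : Fin 4 → ℤ => t ρ • T₁ j c e t) 0) (htel₁ : HessianTelescoping Lc T₁ 𝒯₁)
    (hTA₂ : ∀ j c e, AbsMoment₂ (T₂ j c e)) (hT0₂ : ∀ j c e, HasSum (T₂ j c e) 0)
    (hT1₂ : ∀ j c e (ρ : Fin 4), HasSum (fun t : Fin 4 → ℤ => t ρ • T₂ j c e t) 0) (htel₂ : HessianTelescoping (Lc ^ n) T₂ 𝒯₂)
    {F : Tensor4 → ℝ} (hFadd : ∀ A B, F (A + B) = F A + F B)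
    {β₁ β₂ : ℕ → ℝ} (hβ₁ : ∀ j, β₁ j = F (m2Tensor (T₁ j))) (hβ₂ : ∀ j, β₂ j = F (m2Tensor (T₂ j)))
    {N : ℝ} {μ ν : Fin 4} {a : ℝ} {SL : Finset L} {k : L → Fin 4} {U₁ U₂ : ℝ}
    (h₁ : OneShotFullSum Lc F 𝒯₁ N μ ν a SL k U₁) (h₂ : OneShotFullSum (Lc ^ n) F 𝒯₂ N μ ν a SL k U₂) (hn : 1 ≤ n) :
    ∀ m : ℕ, 1 ≤ m → |∑ j ∈ range (n * m), β₁ j - ∑ j ∈ range m, β₂ j| ≤ U₁ + U₂ := by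
  intro m hm
  rw [flowSum_eq_oneShotReadout hTA₁ hT0₁ hT1₁ htel₁ hFadd hβ₁ (one_le_mul_of_one_le hn hm),
    flowSum_eq_oneShotReadout hTA₂ hT0₂ hT1₂ htel₂ hFadd hβ₂ hm]
  exact lTransfer_oneShot_le h₁ h₂ hn m hm

end LTransfer

/-! ## §5 (v1.2) The PRINTED read-out (1.22) as the socket's `F` — RULING (R20-3) «Fbal := the typed (1.22) read-out» BY NAME

`DressedMomentNormalisation.EKer 4` and `B12Beta.Kernel 4` are the same type `Fin 4 → Fin 4 → (Fin 4 → ℤ) → ℝ`, and the diagonal-pair entry of the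
second-moment tensor `m2Tensor T μ ν μ ν = Σ'_t t_μ t_ν · T μ ν t` IS the printed (1.22) second moment `B12Beta.secondMoment T μ ν = Σ'_x T μ ν x · x_μ · x_ν`
([Balaban1987RG1] p. 264 (1.22) «β_{j+1}(g_j) = … = Σ_x Π_{j+1,μν}(g_j,x) x_μ x_ν for μ, ν arbitrary, μ ≠ ν» — quoted and typed in `B12Beta`, not re-quoted
here).  So the socket's additive read-out `F` is, for Bałaban's coefficient, the coordinate functional `readout122 μ ν`, and nothing abstract remains in
the read-out slot of EXIT-B. -/

section Readout122

open Literature.MathematicalPhysics.QuantumFieldTheory.Balaban1983to89.B12Beta (secondMoment)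

/-- The (1.22) READ-OUT on second-moment tensors: the `(κ, λ, a, b) = (μ, ν, μ, ν)` coordinate. [folklore] -/
def readout122 (μ ν : Fin 4) : Tensor4 → ℝ := fun M => M μ ν μ ν

/-- `readout122` is additive (definitionally). [folklore] -/
theorem readout122_add (μ ν : Fin 4) (A B : Tensor4) : readout122 μ ν (A + B) = readout122 μ ν A + readout122 μ ν B := rfl

/-- **The second-moment tensor's diagonal-pair entry IS the printed (1.22) second moment** `B12Beta.secondMoment`. [folklore] -/
theorem readout122_m2Tensor (μ ν : Fin 4) (T : EKer 4) : readout122 μ ν (m2Tensor T) = secondMoment T μ ν := by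
  unfold readout122 m2Tensor secondMoment
  refine tsum_congr fun t => ?_
  rw [zsmul_eq_mul]
  push_cast
  ring

/-- `OneShotFullSum` with the (1.22) read-out, unfolded: the printed second moment of the one-shot kernel stays within `U` of the free full sums
`oneShotSide` at every scale `Lc^m` — the shape of `D1Rep` in RULING (R20-3). [folklore] -/
theorem oneShotFullSum_readout122_iff {Lc : ℕ} {𝒯 : ℕ → EKer 4} {N : ℝ} {μ ν : Fin 4} {a : ℝ} {SL : Finset L} {k : L → Fin 4} {U : ℝ} :
    OneShotFullSum Lc (readout122 μ ν) 𝒯 N μ ν a SL k U ↔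
      ∀ m : ℕ, 1 ≤ m → |secondMoment (𝒯 m) μ ν - oneShotSide SL μ ν N a k (Lc ^ m)| ≤ U := by
  simp only [oneShotFullSum_iff_oneShotSide, readout122_m2Tensor]

/-- **END-TO-END WITH THE PRINTED READ-OUT**: `endpointExistence_of_scalewise_vectorSeam` at `F := readout122 μ ν`, the one-loop read-out binder in the
printed form `hβ : ∀ j, β⁰_j = secondMoment (T j) μ ν` ((1.22) for the step-j kernel) and `D1Rep` about `secondMoment (𝒯 m) μ ν`.  «END statement modulo
{h12, h126 by name, scale-wise one-loop data, HessianTelescoping, OneShotFullSum, (D4), (D5)}»; NOT `BetaPertH`, NOT continuum, NOT Clay. [folklore] -/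
theorem endpointExistence_of_scalewise_vectorSeam_readout122 (a : ℝ) (ha : 0 < a)
    (h12 : B5.Prop12Printed (fam (fun i : ℕ+ × ℕ => ((i.1 : ℕ+) : ℕ)) (fun i => i.1.pos) MvE a ha))
    (h126 : B5.Kernel126_127Printed (kfam (fun i : ℕ+ × ℕ => ((i.1 : ℕ+) : ℕ)) MvE))
    {SL : Finset L} (hSL : SL.Nonempty) (k : L → Fin 4) {μ ν : Fin 4}
    {β : HBeta} {Cn : B12.Construction} (hgen : ForwardGenerated Cn β)
    (Sβ : B12Beta.OneLoopSplit β) (hμν : μ ≠ ν) {N : ℝ} (hN : N ≠ 0) {Lc : ℕ} [NeZero Lc] (hL : 2 ≤ Lc)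
    (T 𝒯 : ℕ → EKer 4) (hTA : ∀ j c e, AbsMoment₂ (T j c e)) (hT0 : ∀ j c e, HasSum (T j c e) 0)
    (hT1 : ∀ j c e (ρ : Fin 4), HasSum (fun t : Fin 4 → ℤ => t ρ • T j c e t) 0)
    (hβ : ∀ j, Sβ.β0 j = secondMoment (T j) μ ν)
    (htel : HessianTelescoping Lc T 𝒯)
    {U cc : ℝ} {M : ℕ → ℕ}
    (hc : 1 ≤ cc) (hM : ∀ L : ℕ, 2 ≤ L → 1 ≤ M L ∧ (L : ℝ) ≤ cc * M L) (hML : ∀ L : ℕ, 2 ≤ L → M L ≤ L)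
    (hrep : ∀ m : ℕ, 1 ≤ m → |secondMoment (𝒯 m) μ ν - oneShotSide SL μ ν N a k (Lc ^ m)| ≤ U)
    {rr γ₀ β' : ℝ} (hγ₀ : 0 < γ₀) (hrem : RemainderConst Sβ γ₀ rr) (hr : rr ≤ B12Normalization.stepBal N Lc)
    (hβ' : 0 ≤ β') (hcont : BetaContH γ₀ β) (hup : BetaUpperH β' γ₀ β) : EndpointExistence Cn :=
  endpointExistence_of_scalewise_vectorSeam a ha h12 h126 hSL k hgen Sβ hμν hN hL T 𝒯 hTA hT0 hT1 (readout122 μ ν)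
    (readout122_add μ ν) (fun j => by rw [readout122_m2Tensor]; exact hβ j) htel hc hM hML
    (oneShotFullSum_readout122_iff.mpr hrep) hγ₀ hrem hr hβ' hcont hup

/-- **… with (T0)/(T1) from divergence-freeness + midpoint inversion.** [folklore] -/
theorem endpointExistence_of_scalewise_vectorSeam_readout122_of_symmetries (a : ℝ) (ha : 0 < a)
    (h12 : B5.Prop12Printed (fam (fun i : ℕ+ × ℕ => ((i.1 : ℕ+) : ℕ)) (fun i => i.1.pos) MvE a ha))
    (h126 : B5.Kernel126_127Printed (kfam (fun i : ℕ+ × ℕ => ((i.1 : ℕ+) : ℕ)) MvE))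
    {SL : Finset L} (hSL : SL.Nonempty) (k : L → Fin 4) {μ ν : Fin 4}
    {β : HBeta} {Cn : B12.Construction} (hgen : ForwardGenerated Cn β)
    (Sβ : B12Beta.OneLoopSplit β) (hμν : μ ≠ ν) {N : ℝ} (hN : N ≠ 0) {Lc : ℕ} [NeZero Lc] (hL : 2 ≤ Lc)
    (T 𝒯 : ℕ → EKer 4) (hTA : ∀ j c e, AbsMoment₂ (T j c e))
    (hdiv : ∀ j (ν' : Fin 4) (x : Fin 4 → ℤ), ∑ μ', (T j μ' ν' x - T j μ' ν' (x - Pi.single μ' 1)) = 0)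
    (hinv : ∀ j (μ' ν' : Fin 4) (y : Fin 4 → ℤ), T j μ' ν' ((Pi.single ν' 1 - Pi.single μ' 1) - y) = T j μ' ν' y)
    (hβ : ∀ j, Sβ.β0 j = secondMoment (T j) μ ν)
    (htel : HessianTelescoping Lc T 𝒯)
    {U cc : ℝ} {M : ℕ → ℕ}
    (hc : 1 ≤ cc) (hM : ∀ L : ℕ, 2 ≤ L → 1 ≤ M L ∧ (L : ℝ) ≤ cc * M L) (hML : ∀ L : ℕ, 2 ≤ L → M L ≤ L)
    (hrep : ∀ m : ℕ, 1 ≤ m → |secondMoment (𝒯 m) μ ν - oneShotSide SL μ ν N a k (Lc ^ m)| ≤ U)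
    {rr γ₀ β' : ℝ} (hγ₀ : 0 < γ₀) (hrem : RemainderConst Sβ γ₀ rr) (hr : rr ≤ B12Normalization.stepBal N Lc)
    (hβ' : 0 ≤ β') (hcont : BetaContH γ₀ β) (hup : BetaUpperH β' γ₀ β) : EndpointExistence Cn :=
  endpointExistence_of_scalewise_vectorSeam_of_symmetries a ha h12 h126 hSL k hgen Sβ hμν hN hL T 𝒯 hTA hdiv hinv
    (readout122 μ ν) (readout122_add μ ν) (fun j => by rw [readout122_m2Tensor]; exact hβ j) htel hc hM hML
    (oneShotFullSum_readout122_iff.mpr hrep) hγ₀ hrem hr hβ' hcont hup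

end Readout122

/-! ## §6 (v1.3) (T0)/(T1) and `AbsMoment₂` FROM THE PRINTED PROPERTIES (5.7)/(5.9)/(5.10) — EXIT-B's kernel-side obligations, by an1's names

[Balaban1987RG1] p. 293 prints for the vacuum-polarization kernel: (5.7) reflection covariance, (5.8) index symmetry, (5.9) the Ward identity
`Σ_μ ∂*_μ Π_{μν} = 0`, (5.10) exponential decay — quoted and typed in `Beta/PolarizationSign` (an1) as `AxisReflectionCovariant`, `IndexSymmetric`,
`WardTransversal`, `B12Sec2to5.Decay510`; their consequences «every first moment vanishes» ((5.7) alone) and «every zeroth moment vanishes» ((5.9) +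
summability) are an1's `OddMoments.firstMoment_eq_zero_of_reflectionCovariant` and `PolarizationSign.tsum_eq_zero_of_ward`.  These ARE the socket's
(T1) and (T0).  Nothing printed is used as a hypothesis here: the END corollary ASKS for the three properties of the GENUINE kernels (for (T-def):
structural theorems about `Tbal j`), it does not assume them of Bałaban's. -/

section PrintedSymmetries

open Literature.MathematicalPhysics.QuantumFieldTheory.Balaban1983to89.B12Beta (secondMoment)
open Literature.MathematicalPhysics.QuantumFieldTheory.Balaban1983to89.Beta.PolarizationSign
  (WardTransversal AxisReflectionCovariant MomentSummable tsum_eq_zero_of_ward momentSummable_of_decay510)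
open Literature.MathematicalPhysics.QuantumFieldTheory.Balaban1983to89.Beta.OddMoments
  (firstMoment firstMoment_eq_zero_of_reflectionCovariant summable_self summable_mul_coord)
open Literature.MathematicalPhysics.QuantumFieldTheory.Balaban1983to89.Beta.DecimatedMomentSummable (absMoment₂_of_decay510)

/-- **(T0) FROM THE WARD IDENTITY (5.9)** (+ summable third moments): every channel of the kernel sums to zero, as a `HasSum`. [folklore] -/
theorem hasSum_zero_of_ward {P : EKer 4} (hS : MomentSummable P 3) (hW : WardTransversal P) (c e : Fin 4) : HasSum (P c e) 0 := by
  have h := (summable_self hS c e).hasSum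
  rwa [tsum_eq_zero_of_ward hS hW c e] at h

/-- **(T1) FROM REFLECTION COVARIANCE (5.7)** (+ summable third moments for the `HasSum` form): every first moment of every channel vanishes.
[folklore] -/
theorem hasSum_firstMoment_zero_of_reflection {P : EKer 4} (hS : MomentSummable P 3) (hR : AxisReflectionCovariant P) (c e ρ : Fin 4) :
    HasSum (fun t : Fin 4 → ℤ => t ρ • P c e t) 0 := by
  have hfun : (fun t : Fin 4 → ℤ => t ρ • P c e t) = fun t => P c e t * (t ρ : ℝ) := by
    funext t; rw [zsmul_eq_mul, mul_comm]
  rw [hfun]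
  have h := (summable_mul_coord hS c e ρ).hasSum
  have h0 : ∑' t : Fin 4 → ℤ, P c e t * (t ρ : ℝ) = 0 := firstMoment_eq_zero_of_reflectionCovariant hR c e ρ
  rwa [h0] at h

/-- `AbsMoment₂` and `MomentSummable _ 3` for every channel from a UNIFORM (5.10) decay. [folklore] -/
theorem absMoment₂_and_momentSummable_of_decay {P : EKer 4} {C δ : ℝ} (hδ : 0 < δ) (hdec : ∀ μ ν, B12Sec2to5.Decay510 (P μ ν) C δ) :
    (∀ c e, AbsMoment₂ (P c e)) ∧ MomentSummable P 3 :=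
  ⟨fun c e => absMoment₂_of_decay510 hδ (hdec c e), momentSummable_of_decay510 hδ hdec 3⟩

/-- **END-TO-END FROM THE PRINTED PROPERTIES** — `endpointExistence_of_scalewise_vectorSeam_readout122` with the socket's `hTA`/(T0)/(T1) binders
on the one-step kernels `T j` DISCHARGED from, per step: a uniform (5.10) decay `hdec`, the Ward identity (5.9) `hW`, reflection covariance (5.7)
`hR` (an1's typed predicates BY NAME).  What EXIT-B then asks of brick (T-def) for `T := Tbal`, `𝒯 := 𝒯bal` is EXACTLY: `hdec` (⇐ `ExpKernelCalculus.
decay510_hessKer` once the vertex stencils are `BiLoc`), `hW`, `hR` (structural: gauge and lattice symmetry of the typed system), `htel` (`D1Tel`) and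
`hrep` (`D1Rep`), with `hβ := fun _ => rfl` when `β⁰_j := secondMoment (Tbal j) μ ν`.  «END statement modulo {h12, h126 by name, those, (D4), (D5)}»;
NOT `BetaPertH`, NOT continuum, NOT Clay. [folklore] -/
theorem endpointExistence_of_scalewise_vectorSeam_printed (a : ℝ) (ha : 0 < a)
    (h12 : B5.Prop12Printed (fam (fun i : ℕ+ × ℕ => ((i.1 : ℕ+) : ℕ)) (fun i => i.1.pos) MvE a ha))
    (h126 : B5.Kernel126_127Printed (kfam (fun i : ℕ+ × ℕ => ((i.1 : ℕ+) : ℕ)) MvE))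
    {SL : Finset L} (hSL : SL.Nonempty) (k : L → Fin 4) {μ ν : Fin 4}
    {β : HBeta} {Cn : B12.Construction} (hgen : ForwardGenerated Cn β)
    (Sβ : B12Beta.OneLoopSplit β) (hμν : μ ≠ ν) {N : ℝ} (hN : N ≠ 0) {Lc : ℕ} [NeZero Lc] (hL : 2 ≤ Lc)
    (T 𝒯 : ℕ → EKer 4)
    -- the printed p. 293 properties, asked of the one-step kernels at every step
    (hdec : ∀ j, ∃ C δ : ℝ, 0 < δ ∧ ∀ μ' ν', B12Sec2to5.Decay510 (T j μ' ν') C δ)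
    (hW : ∀ j, WardTransversal (T j)) (hR : ∀ j, AxisReflectionCovariant (T j))
    (hβ : ∀ j, Sβ.β0 j = secondMoment (T j) μ ν)
    (htel : HessianTelescoping Lc T 𝒯)
    {U cc : ℝ} {M : ℕ → ℕ}
    (hc : 1 ≤ cc) (hM : ∀ L : ℕ, 2 ≤ L → 1 ≤ M L ∧ (L : ℝ) ≤ cc * M L) (hML : ∀ L : ℕ, 2 ≤ L → M L ≤ L)
    (hrep : ∀ m : ℕ, 1 ≤ m → |secondMoment (𝒯 m) μ ν - oneShotSide SL μ ν N a k (Lc ^ m)| ≤ U)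
    {rr γ₀ β' : ℝ} (hγ₀ : 0 < γ₀) (hrem : RemainderConst Sβ γ₀ rr) (hr : rr ≤ B12Normalization.stepBal N Lc)
    (hβ' : 0 ≤ β') (hcont : BetaContH γ₀ β) (hup : BetaUpperH β' γ₀ β) : EndpointExistence Cn := by
  have hAS : ∀ j, (∀ c e, AbsMoment₂ (T j c e)) ∧ MomentSummable (T j) 3 := fun j => by
    obtain ⟨C, δ, hδ, hd⟩ := hdec j
    exact absMoment₂_and_momentSummable_of_decay hδ hd
  exact endpointExistence_of_scalewise_vectorSeam_readout122 a ha h12 h126 hSL k hgen Sβ hμν hN hL T 𝒯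
    (fun j => (hAS j).1) (fun j c e => hasSum_zero_of_ward (hAS j).2 (hW j) c e)
    (fun j c e ρ => hasSum_firstMoment_zero_of_reflection (hAS j).2 (hR j) c e ρ) hβ htel hc hM hML hrep
    hγ₀ hrem hr hβ' hcont hup

end PrintedSymmetries

/-! ## §7 (v1.5) THE DRIFT EXPOSED — (D1) ⟹ `OneLoopDrift (stepBal N Lc)` on the vector road, by name

Inside the END chain (`VectorTailsSeam.endpointExistence_of_vectorTails_vol` → `WallVolumeTransfer` → `SquareTableAvgFirst.oneLoopDrift_of_scalarBounds_avgFirst` →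
`endpointExistence_of_drift_remainderConst`) the one-loop content of the wall is converted into a DRIFT statement `OneLoopDrift (stepBal N Lc) A β⁰` —
`|Σ_{j<k} β⁰_j − k · stepBal N Lc| ≤ A` for every `k` — and only then combined with (D4)/(D5).  This section exposes that intermediate conclusion at the
even-volume instance of the vector road (same hypotheses as `VectorLegVolumeAdapter.endpointExistence_of_vectorTails_evenVolume` minus the (D4)/(D5)/structural
run-side binders), and in the printed-symmetries form of §6.  [folklore] bookkeeping; the drift value `stepBal N Lc` and the constant `A` are the chain's. -/

section DriftExposure

open Literature.MathematicalPhysics.QuantumFieldTheory.Balaban1983to89.B12Beta (secondMoment)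
open Literature.MathematicalPhysics.QuantumFieldTheory.Balaban1983to89.Beta.Drift (OneLoopDrift)
open Literature.MathematicalPhysics.QuantumFieldTheory.Balaban1983to89.Beta.VectorTailsPt (wall_rows_mod)
open Literature.MathematicalPhysics.QuantumFieldTheory.Balaban1983to89.Beta.VectorTailsWindow (hRows_of_gamma Dvec_nonneg)
open Literature.MathematicalPhysics.QuantumFieldTheory.Balaban1983to89.Beta.VectorTailsBlock (X₀L lwrapped_hX lshift lshift_mem_lblock_iff)
open Literature.MathematicalPhysics.QuantumFieldTheory.Balaban1983to89.Beta.VectorTailsSeam (uwt_nonneg sum_uwt uwt_shift)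
open Literature.MathematicalPhysics.QuantumFieldTheory.Balaban1983to89.Beta.WallVolumeTransfer
  (h0_avg_vol h1_avg_vol h1x_vol h2x_vol d0_avg_vol d1_avg_vol d1x_vol d2x_vol)
open Literature.MathematicalPhysics.QuantumFieldTheory.Balaban1983to89.Beta.SquareTableAvgFirst (oneLoopDrift_of_scalarBounds_avgFirst)
open Literature.MathematicalPhysics.QuantumFieldTheory.Balaban1983to89.Beta.VectorLegVolumeAdapter
  (hgrowE DE_nonneg hG_E hg_E h0S_E h1S_E h1xS_E h2xS_E)
open Literature.MathematicalPhysics.QuantumFieldTheory.Balaban1983to89.Beta.VectorTailsPt (abs_re_le)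
open Literature.MathematicalPhysics.QuantumFieldTheory.Balaban1983to89.Beta.PolarizationSign (WardTransversal AxisReflectionCovariant MomentSummable)

/-- **THE DRIFT ON THE VECTOR ROAD (even cubic volume), BY NAME.**  From the two printed Props BY NAME (h12, h126), base-point labels, table/window data and the
(R17) full-sum binder `hU` (about the explicit `K^∞` legs `GfE`): the composed one-loop coefficients satisfy `OneLoopDrift (stepBal N Lc) A S.β0` for some `A` —
the chain's lattice asymptotic-freedom step (AF-0), previously visible only inside `endpointExistence_of_vectorTails_evenVolume`. [folklore] -/
theorem oneLoopDrift_of_vectorTails_evenVolume (a : ℝ) (ha : 0 < a)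
    (h12 : B5.Prop12Printed (fam (fun i : ℕ+ × ℕ => ((i.1 : ℕ+) : ℕ)) (fun i => i.1.pos) MvE a ha))
    (h126 : B5.Kernel126_127Printed (kfam (fun i : ℕ+ × ℕ => ((i.1 : ℕ+) : ℕ)) MvE))
    {SL : Finset L} (hSL : SL.Nonempty) (k : L → Fin 4) {μ ν : Fin 4}
    {β : HBeta} (S : B12Beta.OneLoopSplit β) (hμν : μ ≠ ν) {N : ℝ} (hN : N ≠ 0) {Lc : ℕ} (hL : 2 ≤ Lc)
    {μC : ℕ → ℕ → ℝ} {U cc : ℝ} {M : ℕ → ℕ}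
    (hc : 1 ≤ cc) (hM : ∀ L : ℕ, 2 ≤ L → 1 ≤ M L ∧ (L : ℝ) ≤ cc * M L) (hML : ∀ L : ℕ, 2 ≤ L → M L ≤ L)
    (hU : ∀ m : ℕ, 1 ≤ m → |composedCoeff μC m - oneShotSide SL μ ν N a k (Lc ^ m)| ≤ U)
    (hid : IdentityForm μC S.β0) :
    ∃ A : ℝ, OneLoopDrift (B12Normalization.stepBal N Lc) A S.β0 := by
  obtain ⟨δ, A, hδ, hA, d0T, d1T, d1xT, d2xT⟩ :=
    wall_rows_mod MvE a ha h12 h126 hgrowE (X₀L MvE) (fun _ b => k b.2) (fun _ b => k b.2) Complex.reAddGroupHom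
      abs_re_le (lblock SL) (fun n => lshift n μ) (μ := μ) (ν := ν) (lwrapped_hX MvE SL μ) (fun _ _ _ => rfl) (fun _ _ _ => rfl)
  obtain ⟨H0, H1, H1x, H2x⟩ :=
    hRows_of_gamma MvE a ha (X₀L MvE) (fun _ b => k b.2) (fun _ b => k b.2) abs_re_le (lblock SL) (fun n => lshift n μ)
      (lwrapped_hX MvE SL μ) (fun _ _ _ => rfl) (fun _ _ _ => rfl) _ _
      (h0S_E a ha SL k) (h1S_E a ha SL k) (h1xS_E a ha SL k μ) (h2xS_E a ha SL k μ ν)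
  have hshB : ∀ n : ℕ, 2 ≤ n → ∀ b, lshift n μ b ∈ lblock SL n ↔ b ∈ lblock SL n := fun n _ b => lshift_mem_lblock_iff SL n μ b
  exact ⟨_, oneLoopDrift_of_scalarBounds_avgFirst S hμν hN hL (Dvec_nonneg DE_nonneg ha) hA hδ
    (fun n _ b _ => uwt_nonneg SL n b) (fun n hn => sum_uwt hSL n (by omega)) hshB (fun n _ b _ => uwt_shift SL n μ b) hc hM hML
    (h0_avg_vol (hG_E a ha SL k) (hg_E a ha SL) H0) (h1_avg_vol (hG_E a ha SL k) (hg_E a ha SL) H1)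
    (h1x_vol hshB (hG_E a ha SL k) H1x) (h2x_vol hshB (hG_E a ha SL k) (hg_E a ha SL) H2x)
    (d0_avg_vol (hG_E a ha SL k) d0T) (d1_avg_vol (hG_E a ha SL k) d1T) (d1x_vol hshB (hG_E a ha SL k) d1xT)
    (d2x_vol hshB (hG_E a ha SL k) d2xT) hU hid⟩

/-- **THE DRIFT FROM THE PRINTED-SYMMETRIES DATA** (§6's hypotheses): with one-step kernels `T j` carrying uniform (5.10) decay, the Ward identity (5.9) and
reflection covariance (5.7), the read-out `β⁰_j = secondMoment (T j) μ ν`, telescoping to `𝒯`, and `D1Rep` in `secondMoment` form, the one-loop coefficients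
satisfy `OneLoopDrift (stepBal N Lc) A Sβ.β0`.  This is what EXIT-A delivers BEFORE (D4)/(D5): lattice one-loop asymptotic freedom of the typed system. [folklore] -/
theorem oneLoopDrift_of_scalewise_printed (a : ℝ) (ha : 0 < a)
    (h12 : B5.Prop12Printed (fam (fun i : ℕ+ × ℕ => ((i.1 : ℕ+) : ℕ)) (fun i => i.1.pos) MvE a ha))
    (h126 : B5.Kernel126_127Printed (kfam (fun i : ℕ+ × ℕ => ((i.1 : ℕ+) : ℕ)) MvE))
    {SL : Finset L} (hSL : SL.Nonempty) (k : L → Fin 4) {μ ν : Fin 4}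
    {β : HBeta} (Sβ : B12Beta.OneLoopSplit β) (hμν : μ ≠ ν) {N : ℝ} (hN : N ≠ 0) {Lc : ℕ} [NeZero Lc] (hL : 2 ≤ Lc)
    (T 𝒯 : ℕ → EKer 4)
    (hdec : ∀ j, ∃ C δ : ℝ, 0 < δ ∧ ∀ μ' ν', B12Sec2to5.Decay510 (T j μ' ν') C δ)
    (hW : ∀ j, WardTransversal (T j)) (hR : ∀ j, AxisReflectionCovariant (T j))
    (hβ : ∀ j, Sβ.β0 j = secondMoment (T j) μ ν)
    (htel : HessianTelescoping Lc T 𝒯)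
    {U cc : ℝ} {M : ℕ → ℕ}
    (hc : 1 ≤ cc) (hM : ∀ L : ℕ, 2 ≤ L → 1 ≤ M L ∧ (L : ℝ) ≤ cc * M L) (hML : ∀ L : ℕ, 2 ≤ L → M L ≤ L)
    (hrep : ∀ m : ℕ, 1 ≤ m → |secondMoment (𝒯 m) μ ν - oneShotSide SL μ ν N a k (Lc ^ m)| ≤ U) :
    ∃ A : ℝ, OneLoopDrift (B12Normalization.stepBal N Lc) A Sβ.β0 := by
  have hAS : ∀ j, (∀ c e, AbsMoment₂ (T j c e)) ∧ MomentSummable (T j) 3 := fun j => by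
    obtain ⟨C, δ, hδ, hd⟩ := hdec j
    exact absMoment₂_and_momentSummable_of_decay hδ hd
  have hβ' : ∀ j, Sβ.β0 j = readout122 μ ν (m2Tensor (T j)) := fun j => by rw [readout122_m2Tensor]; exact hβ j
  have hU' : ∀ m : ℕ, 1 ≤ m → |composedCoeff (fun j _ => Sβ.β0 j) m - oneShotSide SL μ ν N a k (Lc ^ m)| ≤ U :=
    hU_of_scalewise (fun j => (hAS j).1) (fun j c e => hasSum_zero_of_ward (hAS j).2 (hW j) c e)
      (fun j c e ρ => hasSum_firstMoment_zero_of_reflection (hAS j).2 (hR j) c e ρ) htel (readout122_add μ ν)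
      hβ' (oneShotFullSum_readout122_iff.mpr hrep)
  exact oneLoopDrift_of_vectorTails_evenVolume a ha h12 h126 hSL k Sβ hμν hN hL (μC := fun j _ => Sβ.β0 j) hc hM hML hU'
    (identityForm_trivial Sβ.β0)

end DriftExposure

/-! ## §8 (v1.6) THE SOCKET IN THE KERNEL'S CONVENTION AND WITH (D5) = (C) ONLY — RULINGS (R21)/(R22)

(R21) CONVENTION.  an1's typed predicates `WardTransversal` / `AxisReflectionCovariant` (§6) — like §3's `hdiv`/`hinv` — are stated in the PRINT's
difference variable `z = x − y = (base of the μ-bond) − (base of the ν-bond)` ([Balaban1987RG1] p. 292 (5.4)/(5.5), p. 293 (5.7)/(5.8): «Π_{μν}(x, y) = Π_{μν}(x − y)»),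
whereas the jet formalism's one-loop kernels are read at `−z` (`ExpKernelCalculus.hess_eq_hessKer : hess μ y ν y′ = hessKer μ ν (y′ − y)`; an2's
`OneStepResolventKernel.TOf`).  §6 is correct as a theorem over an abstract family `T`, but a `hessKer`-type family obeys the MIRRORED laws
(an2 `KernelReflection.axisReflectionCovariant_flip_hessKer`: the printed (5.7) holds for `fun μ ν z => hessKer A V W μ ν (−z)`), and a kernel obeying BOTH
reflection laws has vanishing off-diagonal channels (an2 CONVENTION NOTE; lit3 ADDENDUM 2).  So the END corollary for such families must ask (5.7)/(5.9) of the
FLIPPED kernels `fun μ ν z => T j μ ν (−z)` (lambda form; an2's `flipK T` unfolds to it): `…_printed_flip`.  Every consumed conclusion — (T0), (T1), `AbsMoment₂`,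
(5.10), `secondMoment` — is flip-insensitive, which is what the transfer lemmas below record.
(R22) (D5) := (C).  Every END of this file derives the drift `OneLoopDrift (stepBal N Lc) A β⁰` (§7) before touching (D4)/(D5); an4's `DriftRemainder` v1.1 §6
(`endpointExistence_of_drift_remainderConst_cont`) shows that on the drift road the printed-type upper bound `BetaUpperH β′ γ₀ β` and its sign are DERIVED
(`β_{k+1} ≤ stepBal + 2A + rr`).  The `_cont` ENDs below therefore drop `hup`/`hβ'`: of row (D5) only joint continuity `BetaContH γ₀ β` remains by name.
[folklore] bookkeeping; nothing printed is asserted; NOT `BetaPertH`, NOT continuum, NOT Clay. -/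

section KernelConvention

open Literature.MathematicalPhysics.QuantumFieldTheory.Balaban1983to89.B12Beta (secondMoment)
open Literature.MathematicalPhysics.QuantumFieldTheory.Balaban1983to89.Beta.PolarizationSign
  (WardTransversal AxisReflectionCovariant MomentSummable)
open Literature.MathematicalPhysics.QuantumFieldTheory.Balaban1983to89.Beta.Drift (OneLoopDrift)
open Literature.MathematicalPhysics.QuantumFieldTheory.Balaban1983to89.Beta.DriftRemainder (endpointExistence_of_drift_remainderConst_cont)

/-- `|·|₁` is even. [folklore] -/
private theorem l1_neg (z : Fin 4 → ℤ) : B12Sec2to5.l1 (-z) = B12Sec2to5.l1 z := by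
  simp [B12Sec2to5.l1, abs_neg]

/-- (5.10)-type decay is insensitive to `z ↦ −z`. [folklore] -/
theorem decay510_flip {P : (Fin 4 → ℤ) → ℝ} {C δ : ℝ} (h : B12Sec2to5.Decay510 P C δ) :
    B12Sec2to5.Decay510 (fun z => P (-z)) C δ := fun z => by
  simpa only [l1_neg] using h (-z)

/-- The per-step `hdec` binder of §6 transfers to the flipped kernels. [folklore] -/
theorem hdec_flip {T : ℕ → EKer 4} (hdec : ∀ j, ∃ C δ : ℝ, 0 < δ ∧ ∀ μ' ν', B12Sec2to5.Decay510 (T j μ' ν') C δ) :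
    ∀ j, ∃ C δ : ℝ, 0 < δ ∧ ∀ μ' ν', B12Sec2to5.Decay510 ((fun μ ν z => T j μ ν (-z)) μ' ν') C δ := fun j => by
  obtain ⟨C, δ, hδ, h⟩ := hdec j
  exact ⟨C, δ, hδ, fun μ' ν' => decay510_flip (h μ' ν')⟩

/-- (T0) is flip-insensitive: a channel of the flipped kernel sums to `0` iff the channel does (re-indexing `z ↦ −z`). [folklore] -/
theorem hasSum_zero_flip_iff {f : (Fin 4 → ℤ) → ℝ} : HasSum (fun z => f (-z)) 0 ↔ HasSum f 0 :=
  (Equiv.neg (Fin 4 → ℤ)).hasSum_iff (f := f) (a := 0)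

/-- (T1) is flip-insensitive: the first moments of the flipped kernel vanish iff those of the kernel do. [folklore] -/
theorem hasSum_firstMoment_zero_flip_iff {f : (Fin 4 → ℤ) → ℝ} (ρ : Fin 4) :
    HasSum (fun t : Fin 4 → ℤ => t ρ • f (-t)) 0 ↔ HasSum (fun t : Fin 4 → ℤ => t ρ • f t) 0 := by
  have key : ∀ g : (Fin 4 → ℤ) → ℝ,
      HasSum (fun t : Fin 4 → ℤ => t ρ • g (-t)) 0 → HasSum (fun t : Fin 4 → ℤ => t ρ • g t) 0 := by
    intro g h
    have h1 : HasSum (fun t : Fin 4 → ℤ => (-t) ρ • g t) 0 := by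
      have := ((Equiv.neg (Fin 4 → ℤ)).hasSum_iff (f := fun t : Fin 4 → ℤ => (-t) ρ • g t) (a := 0)).mp
      refine this ?_
      simpa only [Function.comp_def, Equiv.neg_apply, neg_neg] using h
    have h2 := h1.neg
    simp only [Pi.neg_apply, neg_zsmul, neg_neg, neg_zero] at h2
    exact h2
  refine ⟨key f, fun h => ?_⟩
  have := key (fun t => f (-t)) (by simpa only [neg_neg] using h)
  exact this

/-- **(T0) FROM THE WARD IDENTITY OF THE FLIPPED KERNEL** ((5.9) in the kernel's convention = forward first-index divergence of `P`). [folklore] -/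
theorem hasSum_zero_of_ward_flip {P : EKer 4} (hS : MomentSummable (fun μ ν z => P μ ν (-z)) 3)
    (hW : WardTransversal (fun μ ν z => P μ ν (-z))) (c e : Fin 4) : HasSum (P c e) 0 :=
  hasSum_zero_flip_iff.mp (hasSum_zero_of_ward hS hW c e)

/-- **(T1) FROM REFLECTION COVARIANCE OF THE FLIPPED KERNEL** ((5.7) in the kernel's convention). [folklore] -/
theorem hasSum_firstMoment_zero_of_reflection_flip {P : EKer 4} (hS : MomentSummable (fun μ ν z => P μ ν (-z)) 3)
    (hR : AxisReflectionCovariant (fun μ ν z => P μ ν (-z))) (c e ρ : Fin 4) :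
    HasSum (fun t : Fin 4 → ℤ => t ρ • P c e t) 0 :=
  (hasSum_firstMoment_zero_flip_iff ρ).mp (hasSum_firstMoment_zero_of_reflection hS hR c e ρ)

/-- The socket's per-step data (hTA, (T0), (T1)) from `hdec` on `T` and the printed laws on the FLIPPED kernels. [folklore] -/
theorem scalewiseData_of_printed_flip {T : ℕ → EKer 4}
    (hdec : ∀ j, ∃ C δ : ℝ, 0 < δ ∧ ∀ μ' ν', B12Sec2to5.Decay510 (T j μ' ν') C δ)
    (hW : ∀ j, WardTransversal (fun μ ν z => T j μ ν (-z))) (hR : ∀ j, AxisReflectionCovariant (fun μ ν z => T j μ ν (-z))) :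
    (∀ j c e, AbsMoment₂ (T j c e)) ∧ (∀ j c e, HasSum (T j c e) 0) ∧
      (∀ j c e (ρ : Fin 4), HasSum (fun t : Fin 4 → ℤ => t ρ • T j c e t) 0) := by
  have hAS : ∀ j, (∀ c e, AbsMoment₂ (T j c e)) ∧ MomentSummable (T j) 3 := fun j => by
    obtain ⟨C, δ, hδ, hd⟩ := hdec j
    exact absMoment₂_and_momentSummable_of_decay hδ hd
  have hASf : ∀ j, MomentSummable (fun μ ν z => T j μ ν (-z)) 3 := fun j => by
    obtain ⟨C, δ, hδ, hd⟩ := hdec_flip hdec j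
    exact (absMoment₂_and_momentSummable_of_decay (P := fun μ ν z => T j μ ν (-z)) hδ hd).2
  exact ⟨fun j => (hAS j).1, fun j c e => hasSum_zero_of_ward_flip (hASf j) (hW j) c e,
    fun j c e ρ => hasSum_firstMoment_zero_of_reflection_flip (hASf j) (hR j) c e ρ⟩

/-- **END-TO-END FROM THE PRINTED PROPERTIES IN THE KERNEL'S CONVENTION** (RULING (R21-2)): §6's `…_printed` with `hW`/`hR` asked of the FLIPPED one-step
kernels `fun μ ν z => T j μ ν (−z)` — the form in which they hold for `hessKer`-type families (an2 `KernelReflection`) — everything else verbatim.  «END statement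
modulo {h12, h126 by name, hdec/hW♭/hR♭, hβ, D1Tel, D1Rep, (D4), (D5)}»; NOT `BetaPertH`, NOT continuum, NOT Clay. [folklore] -/
theorem endpointExistence_of_scalewise_vectorSeam_printed_flip (a : ℝ) (ha : 0 < a)
    (h12 : B5.Prop12Printed (fam (fun i : ℕ+ × ℕ => ((i.1 : ℕ+) : ℕ)) (fun i => i.1.pos) MvE a ha))
    (h126 : B5.Kernel126_127Printed (kfam (fun i : ℕ+ × ℕ => ((i.1 : ℕ+) : ℕ)) MvE))
    {SL : Finset L} (hSL : SL.Nonempty) (k : L → Fin 4) {μ ν : Fin 4}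
    {β : HBeta} {Cn : B12.Construction} (hgen : ForwardGenerated Cn β)
    (Sβ : B12Beta.OneLoopSplit β) (hμν : μ ≠ ν) {N : ℝ} (hN : N ≠ 0) {Lc : ℕ} [NeZero Lc] (hL : 2 ≤ Lc)
    (T 𝒯 : ℕ → EKer 4)
    -- the printed p. 293 properties: (5.10) of the one-step kernels, (5.9)/(5.7) of their FLIPS (kernel convention)
    (hdec : ∀ j, ∃ C δ : ℝ, 0 < δ ∧ ∀ μ' ν', B12Sec2to5.Decay510 (T j μ' ν') C δ)
    (hW : ∀ j, WardTransversal (fun μ ν z => T j μ ν (-z))) (hR : ∀ j, AxisReflectionCovariant (fun μ ν z => T j μ ν (-z)))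
    (hβ : ∀ j, Sβ.β0 j = secondMoment (T j) μ ν)
    (htel : HessianTelescoping Lc T 𝒯)
    {U cc : ℝ} {M : ℕ → ℕ}
    (hc : 1 ≤ cc) (hM : ∀ L : ℕ, 2 ≤ L → 1 ≤ M L ∧ (L : ℝ) ≤ cc * M L) (hML : ∀ L : ℕ, 2 ≤ L → M L ≤ L)
    (hrep : ∀ m : ℕ, 1 ≤ m → |secondMoment (𝒯 m) μ ν - oneShotSide SL μ ν N a k (Lc ^ m)| ≤ U)
    {rr γ₀ β' : ℝ} (hγ₀ : 0 < γ₀) (hrem : RemainderConst Sβ γ₀ rr) (hr : rr ≤ B12Normalization.stepBal N Lc)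
    (hβ' : 0 ≤ β') (hcont : BetaContH γ₀ β) (hup : BetaUpperH β' γ₀ β) : EndpointExistence Cn := by
  obtain ⟨hTA, hT0, hT1⟩ := scalewiseData_of_printed_flip hdec hW hR
  exact endpointExistence_of_scalewise_vectorSeam_readout122 a ha h12 h126 hSL k hgen Sβ hμν hN hL T 𝒯 hTA hT0 hT1 hβ htel
    hc hM hML hrep hγ₀ hrem hr hβ' hcont hup

/-- **THE DRIFT FROM THE PRINTED PROPERTIES IN THE KERNEL'S CONVENTION**: §7's `oneLoopDrift_of_scalewise_printed` with `hW`/`hR` on the flipped kernels.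
[folklore] -/
theorem oneLoopDrift_of_scalewise_printed_flip (a : ℝ) (ha : 0 < a)
    (h12 : B5.Prop12Printed (fam (fun i : ℕ+ × ℕ => ((i.1 : ℕ+) : ℕ)) (fun i => i.1.pos) MvE a ha))
    (h126 : B5.Kernel126_127Printed (kfam (fun i : ℕ+ × ℕ => ((i.1 : ℕ+) : ℕ)) MvE))
    {SL : Finset L} (hSL : SL.Nonempty) (k : L → Fin 4) {μ ν : Fin 4}
    {β : HBeta} (Sβ : B12Beta.OneLoopSplit β) (hμν : μ ≠ ν) {N : ℝ} (hN : N ≠ 0) {Lc : ℕ} [NeZero Lc] (hL : 2 ≤ Lc)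
    (T 𝒯 : ℕ → EKer 4)
    (hdec : ∀ j, ∃ C δ : ℝ, 0 < δ ∧ ∀ μ' ν', B12Sec2to5.Decay510 (T j μ' ν') C δ)
    (hW : ∀ j, WardTransversal (fun μ ν z => T j μ ν (-z))) (hR : ∀ j, AxisReflectionCovariant (fun μ ν z => T j μ ν (-z)))
    (hβ : ∀ j, Sβ.β0 j = secondMoment (T j) μ ν)
    (htel : HessianTelescoping Lc T 𝒯)
    {U cc : ℝ} {M : ℕ → ℕ}
    (hc : 1 ≤ cc) (hM : ∀ L : ℕ, 2 ≤ L → 1 ≤ M L ∧ (L : ℝ) ≤ cc * M L) (hML : ∀ L : ℕ, 2 ≤ L → M L ≤ L)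
    (hrep : ∀ m : ℕ, 1 ≤ m → |secondMoment (𝒯 m) μ ν - oneShotSide SL μ ν N a k (Lc ^ m)| ≤ U) :
    ∃ A : ℝ, OneLoopDrift (B12Normalization.stepBal N Lc) A Sβ.β0 := by
  obtain ⟨hTA, hT0, hT1⟩ := scalewiseData_of_printed_flip hdec hW hR
  have hβ' : ∀ j, Sβ.β0 j = readout122 μ ν (m2Tensor (T j)) := fun j => by rw [readout122_m2Tensor]; exact hβ j
  have hU' : ∀ m : ℕ, 1 ≤ m → |composedCoeff (fun j _ => Sβ.β0 j) m - oneShotSide SL μ ν N a k (Lc ^ m)| ≤ U :=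
    hU_of_scalewise hTA hT0 hT1 htel (readout122_add μ ν) hβ' (oneShotFullSum_readout122_iff.mpr hrep)
  exact oneLoopDrift_of_vectorTails_evenVolume a ha h12 h126 hSL k Sβ hμν hN hL (μC := fun j _ => Sβ.β0 j) hc hM hML hU'
    (identityForm_trivial Sβ.β0)

/-- **THE WALL ON THE VECTOR ROAD WITH (D5) = (C) ONLY** (RULING (R22)): §3's `endpointExistence_of_scalewise_vectorSeam` with the binders `hup : BetaUpperH β′ γ₀ β`
and `hβ' : 0 ≤ β′` DROPPED — the drift of §7 + an4's `DriftRemainder.endpointExistence_of_drift_remainderConst_cont` (the upper bound is derived as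
`stepBal + 2A + rr`).  «END statement modulo {h12, h126 by name, scale-wise one-loop data, HessianTelescoping, OneShotFullSum, (D4), (C)}». [folklore] -/
theorem endpointExistence_of_scalewise_vectorSeam_cont (a : ℝ) (ha : 0 < a)
    (h12 : B5.Prop12Printed (fam (fun i : ℕ+ × ℕ => ((i.1 : ℕ+) : ℕ)) (fun i => i.1.pos) MvE a ha))
    (h126 : B5.Kernel126_127Printed (kfam (fun i : ℕ+ × ℕ => ((i.1 : ℕ+) : ℕ)) MvE))
    {SL : Finset L} (hSL : SL.Nonempty) (k : L → Fin 4) {μ ν : Fin 4}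
    {β : HBeta} {Cn : B12.Construction} (hgen : ForwardGenerated Cn β)
    (Sβ : B12Beta.OneLoopSplit β) (hμν : μ ≠ ν) {N : ℝ} (hN : N ≠ 0) {Lc : ℕ} [NeZero Lc] (hL : 2 ≤ Lc)
    (T 𝒯 : ℕ → EKer 4) (hTA : ∀ j c e, AbsMoment₂ (T j c e)) (hT0 : ∀ j c e, HasSum (T j c e) 0)
    (hT1 : ∀ j c e (ρ : Fin 4), HasSum (fun t : Fin 4 → ℤ => t ρ • T j c e t) 0)
    (F : Tensor4 → ℝ) (hFadd : ∀ A B, F (A + B) = F A + F B) (hβ : ∀ j, Sβ.β0 j = F (m2Tensor (T j)))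
    (htel : HessianTelescoping Lc T 𝒯)
    {U cc : ℝ} {M : ℕ → ℕ}
    (hc : 1 ≤ cc) (hM : ∀ L : ℕ, 2 ≤ L → 1 ≤ M L ∧ (L : ℝ) ≤ cc * M L) (hML : ∀ L : ℕ, 2 ≤ L → M L ≤ L)
    (hrep : OneShotFullSum Lc F 𝒯 N μ ν a SL k U)
    {rr γ₀ : ℝ} (hγ₀ : 0 < γ₀) (hrem : RemainderConst Sβ γ₀ rr) (hr : rr ≤ B12Normalization.stepBal N Lc)
    (hcont : BetaContH γ₀ β) : EndpointExistence Cn := by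
  have hU' : ∀ m : ℕ, 1 ≤ m → |composedCoeff (fun j _ => Sβ.β0 j) m - oneShotSide SL μ ν N a k (Lc ^ m)| ≤ U :=
    hU_of_scalewise hTA hT0 hT1 htel hFadd hβ hrep
  obtain ⟨A, hdrift⟩ := oneLoopDrift_of_vectorTails_evenVolume a ha h12 h126 hSL k Sβ hμν hN hL (μC := fun j _ => Sβ.β0 j)
    hc hM hML hU' (identityForm_trivial Sβ.β0)
  exact endpointExistence_of_drift_remainderConst_cont hgen Sβ hγ₀ hdrift hrem hr hcont

/-- **THE EXIT-B SOCKET, v2 (RULINGS (R21)/(R22) TOGETHER)** — the END statement on the vector road from EXACTLY: the two printed Props BY NAME (h12, h126),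
base-point labels, per-step (5.10) decay `hdec` of the one-step kernels and the printed (5.9)/(5.7) laws `hW`/`hR` OF THEIR FLIPS (kernel convention), the (1.22)
read-out `hβ`, `D1Tel` (`htel`), `D1Rep` (`hrep`, `secondMoment` form), window data, (D4) `RemainderConst` + `rr ≤ stepBal N Lc`, (C) `BetaContH γ₀ β`, structural
`ForwardGenerated`.  NO upper-bound binder, NO abstract read-out / sum-rule / moment slot.  For (T-def): `T j := TOf (J j)`, `𝒯 m := TOf (J𝒯 m)` (an2), `hdec` by
`ExpKernelCalculus.hdec_hessKer`, `hW`/`hR` structural (an2 P5′).  «END statement modulo {h12, h126 by name, hdec/hW♭/hR♭, hβ, D1Tel, D1Rep, (D4), (C)}»; subject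
to the READING CLAUSE; NOT `BetaPertH`, NOT continuum, NOT Clay. [folklore] -/
theorem endpointExistence_of_scalewise_vectorSeam_printed_flip_cont (a : ℝ) (ha : 0 < a)
    (h12 : B5.Prop12Printed (fam (fun i : ℕ+ × ℕ => ((i.1 : ℕ+) : ℕ)) (fun i => i.1.pos) MvE a ha))
    (h126 : B5.Kernel126_127Printed (kfam (fun i : ℕ+ × ℕ => ((i.1 : ℕ+) : ℕ)) MvE))
    {SL : Finset L} (hSL : SL.Nonempty) (k : L → Fin 4) {μ ν : Fin 4}
    {β : HBeta} {Cn : B12.Construction} (hgen : ForwardGenerated Cn β)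
    (Sβ : B12Beta.OneLoopSplit β) (hμν : μ ≠ ν) {N : ℝ} (hN : N ≠ 0) {Lc : ℕ} [NeZero Lc] (hL : 2 ≤ Lc)
    (T 𝒯 : ℕ → EKer 4)
    (hdec : ∀ j, ∃ C δ : ℝ, 0 < δ ∧ ∀ μ' ν', B12Sec2to5.Decay510 (T j μ' ν') C δ)
    (hW : ∀ j, WardTransversal (fun μ ν z => T j μ ν (-z))) (hR : ∀ j, AxisReflectionCovariant (fun μ ν z => T j μ ν (-z)))
    (hβ : ∀ j, Sβ.β0 j = secondMoment (T j) μ ν)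
    (htel : HessianTelescoping Lc T 𝒯)
    {U cc : ℝ} {M : ℕ → ℕ}
    (hc : 1 ≤ cc) (hM : ∀ L : ℕ, 2 ≤ L → 1 ≤ M L ∧ (L : ℝ) ≤ cc * M L) (hML : ∀ L : ℕ, 2 ≤ L → M L ≤ L)
    (hrep : ∀ m : ℕ, 1 ≤ m → |secondMoment (𝒯 m) μ ν - oneShotSide SL μ ν N a k (Lc ^ m)| ≤ U)
    {rr γ₀ : ℝ} (hγ₀ : 0 < γ₀) (hrem : RemainderConst Sβ γ₀ rr) (hr : rr ≤ B12Normalization.stepBal N Lc)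
    (hcont : BetaContH γ₀ β) : EndpointExistence Cn := by
  obtain ⟨A, hdrift⟩ := oneLoopDrift_of_scalewise_printed_flip a ha h12 h126 hSL k Sβ hμν hN hL T 𝒯 hdec hW hR hβ htel hc hM hML hrep
  exact endpointExistence_of_drift_remainderConst_cont hgen Sβ hγ₀ hdrift hrem hr hcont

/-- … and the unflipped §6 form with (D5) = (C) only (for families typed directly in the print's `x − y` variable). [folklore] -/
theorem endpointExistence_of_scalewise_vectorSeam_printed_cont (a : ℝ) (ha : 0 < a)
    (h12 : B5.Prop12Printed (fam (fun i : ℕ+ × ℕ => ((i.1 : ℕ+) : ℕ)) (fun i => i.1.pos) MvE a ha))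
    (h126 : B5.Kernel126_127Printed (kfam (fun i : ℕ+ × ℕ => ((i.1 : ℕ+) : ℕ)) MvE))
    {SL : Finset L} (hSL : SL.Nonempty) (k : L → Fin 4) {μ ν : Fin 4}
    {β : HBeta} {Cn : B12.Construction} (hgen : ForwardGenerated Cn β)
    (Sβ : B12Beta.OneLoopSplit β) (hμν : μ ≠ ν) {N : ℝ} (hN : N ≠ 0) {Lc : ℕ} [NeZero Lc] (hL : 2 ≤ Lc)
    (T 𝒯 : ℕ → EKer 4)
    (hdec : ∀ j, ∃ C δ : ℝ, 0 < δ ∧ ∀ μ' ν', B12Sec2to5.Decay510 (T j μ' ν') C δ)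
    (hW : ∀ j, WardTransversal (T j)) (hR : ∀ j, AxisReflectionCovariant (T j))
    (hβ : ∀ j, Sβ.β0 j = secondMoment (T j) μ ν)
    (htel : HessianTelescoping Lc T 𝒯)
    {U cc : ℝ} {M : ℕ → ℕ}
    (hc : 1 ≤ cc) (hM : ∀ L : ℕ, 2 ≤ L → 1 ≤ M L ∧ (L : ℝ) ≤ cc * M L) (hML : ∀ L : ℕ, 2 ≤ L → M L ≤ L)
    (hrep : ∀ m : ℕ, 1 ≤ m → |secondMoment (𝒯 m) μ ν - oneShotSide SL μ ν N a k (Lc ^ m)| ≤ U)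
    {rr γ₀ : ℝ} (hγ₀ : 0 < γ₀) (hrem : RemainderConst Sβ γ₀ rr) (hr : rr ≤ B12Normalization.stepBal N Lc)
    (hcont : BetaContH γ₀ β) : EndpointExistence Cn := by
  obtain ⟨A, hdrift⟩ := oneLoopDrift_of_scalewise_printed a ha h12 h126 hSL k Sβ hμν hN hL T 𝒯 hdec hW hR hβ htel hc hM hML hrep
  exact endpointExistence_of_drift_remainderConst_cont hgen Sβ hγ₀ hdrift hrem hr hcont

/-! ### (R21) CERTIFIED: both reflection laws force the off-diagonal channels — hence β⁰ — to vanish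

The located vacuity behind RULING (R21) as a KERNEL fact (lit3-g18 ADDENDUM 2's three-line derivation, typed): if a kernel `P` satisfies the printed
reflection covariance (5.7) `AxisReflectionCovariant P` AND its flip does too, then for `ν ≠ α` the channel `P α ν` is `2e_α`-periodic; a summable
periodic function is zero; so every off-diagonal channel vanishes and with it every off-diagonal (1.22) moment.  Consequently the §6 END corollary
`…_printed` instantiated UNFLIPPED at a family that obeys the mirrored law (every `hessKer`-family with reflection-symmetric ingredients — an2
`KernelReflection.axisReflectionCovariant_flip_hessKer`) has `β⁰ ≡ 0` by `hβ`: admissible only vacuously.  [folklore]. -/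

open Literature.MathematicalPhysics.QuantumFieldTheory.Balaban1983to89.B6BondElimination (unitVec unitVec_apply) in
open Literature.MathematicalPhysics.QuantumFieldTheory.Balaban1983to89.Beta.PolarizationSign (axisReflect reflSign) in
/-- Both reflection laws ⟹ the off-diagonal channel `P α ν` (`ν ≠ α`) takes the same value at `w − e_α` and `w + e_α`. [folklore] -/
theorem offDiag_shift_eq_of_both_reflection_laws {P : EKer 4} (hR : AxisReflectionCovariant P)
    (hR' : AxisReflectionCovariant (fun μ ν z => P μ ν (-z))) {α ν : Fin 4} (hνα : ν ≠ α) (w : Fin 4 → ℤ) :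
    P α ν (w - unitVec α) = P α ν (w + unitVec α) := by
  have hneg : ∀ z : Fin 4 → ℤ, axisReflect α (-z) = -axisReflect α z := fun z => by
    funext i; by_cases h : i = α <;> simp [axisReflect, h]
  have hinv : axisReflect α (axisReflect α w) = w := PolarizationSign.axisReflect_axisReflect α w
  have hsign : reflSign α α * reflSign α ν = -1 := by simp [reflSign, hνα]
  -- law A at z := axisReflect α w :  P (w − e_α) = − P (axisReflect α w)
  have hA := hR α α ν (axisReflect α w)
  simp only [if_true, if_neg hνα, add_zero, hinv, hsign] at hA
  -- law B (the flipped kernel) at z := − axisReflect α w :  P (w + e_α) = − P (axisReflect α w)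
  have hB := hR' α α ν (-axisReflect α w)
  simp only [if_true, if_neg hνα, add_zero, hneg, hinv, neg_neg, hsign] at hB
  rw [show -(-w - unitVec α) = w + unitVec α by abel] at hB
  linarith

open Literature.MathematicalPhysics.QuantumFieldTheory.Balaban1983to89.B6BondElimination (unitVec unitVec_apply) in
/-- … hence it is `2e_α`-PERIODIC. [folklore] -/
theorem offDiag_periodic_of_both_reflection_laws {P : EKer 4} (hR : AxisReflectionCovariant P)
    (hR' : AxisReflectionCovariant (fun μ ν z => P μ ν (-z))) {α ν : Fin 4} (hνα : ν ≠ α) (w : Fin 4 → ℤ) (n : ℕ) :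
    P α ν (w + (2 * (n : ℤ)) • unitVec α) = P α ν w := by
  induction n with
  | zero => simp
  | succ n ih =>
    have h := offDiag_shift_eq_of_both_reflection_laws hR hR' hνα (w + (2 * (n : ℤ)) • unitVec α + unitVec α)
    rw [add_sub_cancel_right] at h
    rw [← ih, h]
    congr 1
    push_cast
    simp only [add_smul, mul_add, mul_one, add_assoc]
    norm_num [two_smul, add_assoc]

open Literature.MathematicalPhysics.QuantumFieldTheory.Balaban1983to89.B6BondElimination (unitVec unitVec_apply) in
/-- **BOTH REFLECTION LAWS + SUMMABILITY ⟹ EVERY OFF-DIAGONAL CHANNEL VANISHES** (a summable `2e_α`-periodic function on `ℤ⁴` is zero: it tends to `0`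
along the cofinite filter, hence along the injective progression `n ↦ w + 2n·e_α`, on which it is constant). [folklore] -/
theorem offDiag_eq_zero_of_both_reflection_laws {P : EKer 4} (hS : ∀ μ ν, Summable (P μ ν)) (hR : AxisReflectionCovariant P)
    (hR' : AxisReflectionCovariant (fun μ ν z => P μ ν (-z))) {α ν : Fin 4} (hνα : ν ≠ α) (w : Fin 4 → ℤ) : P α ν w = 0 := by
  set f : ℕ → (Fin 4 → ℤ) := fun n => w + (2 * (n : ℤ)) • unitVec α with hf
  have hinj : Function.Injective f := by
    intro m n h
    have h' := congrArg (fun z : Fin 4 → ℤ => z α) h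
    simp only [hf, Pi.add_apply, Pi.smul_apply, unitVec_apply, if_true, smul_eq_mul, mul_one, add_right_inj] at h'
    exact_mod_cast (mul_right_injective₀ (two_ne_zero' ℤ) h')
  have h0 : Tendsto (P α ν) cofinite (𝓝 0) := (hS α ν).tendsto_cofinite_zero
  have h1 : Tendsto (fun n => P α ν (f n)) atTop (𝓝 0) := by
    rw [← Nat.cofinite_eq_atTop]
    exact h0.comp hinj.tendsto_cofinite
  have h2 : (fun n => P α ν (f n)) = fun _ => P α ν w := funext fun n => offDiag_periodic_of_both_reflection_laws hR hR' hνα w n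
  rw [h2] at h1
  exact tendsto_nhds_unique tendsto_const_nhds h1

/-- **… SO EVERY OFF-DIAGONAL (1.22) MOMENT VANISHES.** [folklore] -/
theorem secondMoment_eq_zero_of_both_reflection_laws {P : EKer 4} (hS : ∀ μ ν, Summable (P μ ν)) (hR : AxisReflectionCovariant P)
    (hR' : AxisReflectionCovariant (fun μ ν z => P μ ν (-z))) {μ ν : Fin 4} (hμν : μ ≠ ν) : secondMoment P μ ν = 0 := by
  unfold secondMoment
  simp [offDiag_eq_zero_of_both_reflection_laws hS hR hR' (Ne.symm hμν)]

/-- **(R21) AS A THEOREM: THE UNFLIPPED INSTANTIATION IS VACUOUS.**  If the one-step kernels carry (5.10) decay and the printed reflection law (5.7)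
AS TYPED (`hR`, the §6 binder) while — being `hessKer`-type — they ALSO obey it in the kernel's convention (`hR♭`), then the (1.22) read-out binder `hβ`
forces `β⁰_j = 0` for every `j`.  (The Ward binder plays no role.) [folklore] -/
theorem beta0_eq_zero_of_unflipped_instantiation {T : ℕ → EKer 4} {β0 : ℕ → ℝ} {μ ν : Fin 4} (hμν : μ ≠ ν)
    (hdec : ∀ j, ∃ C δ : ℝ, 0 < δ ∧ ∀ μ' ν', B12Sec2to5.Decay510 (T j μ' ν') C δ)
    (hR : ∀ j, AxisReflectionCovariant (T j)) (hRflip : ∀ j, AxisReflectionCovariant (fun μ ν z => T j μ ν (-z)))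
    (hβ : ∀ j, β0 j = secondMoment (T j) μ ν) : ∀ j, β0 j = 0 := fun j => by
  obtain ⟨C, δ, hδ, hd⟩ := hdec j
  have hS : ∀ μ' ν', Summable (T j μ' ν') := fun μ' ν' =>
    DecimatedMomentSummable.summable_of_absMoment₂ (DecimatedMomentSummable.absMoment₂_of_decay510 hδ (hd μ' ν'))
  rw [hβ j, secondMoment_eq_zero_of_both_reflection_laws hS (hR j) (hRflip j) hμν]

/-- **`D1Tel` REDUCED (checklist item (iii))**: under the socket's own per-step data (hTA, (T0), (T1)) — in particular under `hdec` + `hW♭` + `hR♭` —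
the pulled-back coarse tensors ARE the second-moment tensors (`MinimiserIdentityForm.coarseTensor_minimiser`, the `d = 4` marginality of the dressing),
so `HessianTelescoping Lc T 𝒯` IS the ADDITIVITY of the second-moment tensors of the one-step kernels onto that of the one-shot kernel:
`m2Tensor (𝒯 m) = Σ_{j<m} m2Tensor (T j)` for every `m ≥ 1`.  For (T-def) (`T := TbalOf`, `𝒯 := TshotOf`) this is what `D1Tel` asks, no more. [folklore] -/
theorem hessianTelescoping_iff_m2Tensor_sum {Lc : ℕ} [NeZero Lc] {T 𝒯 : ℕ → EKer 4}
    (hTA : ∀ j c e, AbsMoment₂ (T j c e)) (hT0 : ∀ j c e, HasSum (T j c e) 0)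
    (hT1 : ∀ j c e (ρ : Fin 4), HasSum (fun t : Fin 4 → ℤ => t ρ • T j c e t) 0) :
    HessianTelescoping Lc T 𝒯 ↔ ∀ m : ℕ, 1 ≤ m → m2Tensor (𝒯 m) = ∑ j ∈ range m, m2Tensor (T j) := by
  have key : ∀ m : ℕ, ∑ j ∈ range m, coarseTensor (Lc ^ (m - j)) (MinimiserIdentityForm.wK (Lc ^ (m - j))) (T j)
      = ∑ j ∈ range m, m2Tensor (T j) := fun m =>
    sum_congr rfl fun j _ => MinimiserIdentityForm.coarseTensor_minimiser (N := Lc ^ (m - j)) (T j) (hTA j) (hT0 j) (hT1 j)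
  refine ⟨fun h m hm => ?_, fun h m hm => ?_⟩
  · rw [← key m]; exact (h m hm).symm
  · rw [key m]; exact (h m hm).symm

/-- … and from the printed properties in the kernel's convention: `hdec` + `hW♭` + `hR♭` ⟹ (`D1Tel` ⟺ second-moment additivity). [folklore] -/
theorem hessianTelescoping_iff_m2Tensor_sum_of_printed_flip {Lc : ℕ} [NeZero Lc] {T 𝒯 : ℕ → EKer 4}
    (hdec : ∀ j, ∃ C δ : ℝ, 0 < δ ∧ ∀ μ' ν', B12Sec2to5.Decay510 (T j μ' ν') C δ)
    (hW : ∀ j, WardTransversal (fun μ ν z => T j μ ν (-z))) (hR : ∀ j, AxisReflectionCovariant (fun μ ν z => T j μ ν (-z))) :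
    HessianTelescoping Lc T 𝒯 ↔ ∀ m : ℕ, 1 ≤ m → m2Tensor (𝒯 m) = ∑ j ∈ range m, m2Tensor (T j) := by
  obtain ⟨hTA, hT0, hT1⟩ := scalewiseData_of_printed_flip hdec hW hR
  exact hessianTelescoping_iff_m2Tensor_sum hTA hT0 hT1

end KernelConvention


/-! ## §9 (v1.6) THE FREE-BUBBLE DRIFT, AND `D1Rep ⟺ OneLoopDrift` — what the (α)-leaves are for

The vector road's chain proves ONE free-field statement and nothing else about Bałaban's construction: the base-point-averaged full sums of the realised
table on the explicit `K^∞` legs at blocking `Lc^n` — `oneShotSide SL μ ν N a k (Lc^n)`, the FREE one-shot bubble — grow like `n · stepBal N Lc` up to a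
bounded error (lattice one-loop asymptotic freedom of the block-spin regularisation, `stepBal N Lc = (11N²/(12π²))·log Lc`).  This section exposes that
statement (`oneShotSide_drift`; inputs = the two printed Props BY NAME + labels + window data, NO β-family) and records the consequence for the wall:
GIVEN the scale-wise data (hTA/(T0)/(T1), `hβ`, `D1Tel`), the representation binder `D1Rep` (the one-shot second moment stays within `U` of the free
bubble) is EQUIVALENT to the drift `∃ A, OneLoopDrift (stepBal N Lc) A β⁰` of the one-loop coefficients themselves (`d1Rep_iff_oneLoopDrift`).  So at END
grade the wall's one-loop item can be stated with NO reference to legs, tables or `K^∞`: «Bałaban's (1.22) coefficients drift with slope `stepBal N Lc`»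
(then an4's `DriftRemainder.endpointExistence_of_drift_remainderConst_cont` is the END); the vector road is the cell's PROOF ROUTE for it, the (α)-leaves
entering only through the free-bubble drift.  [folklore]; nothing printed is asserted. -/

section FreeBubbleDrift

open Literature.MathematicalPhysics.QuantumFieldTheory.Balaban1983to89.B12Beta (secondMoment)
open Literature.MathematicalPhysics.QuantumFieldTheory.Balaban1983to89.Beta.Drift (OneLoopDrift)

/-- The history-independent β-family with prescribed one-loop coefficients and `β¹ := 0` (bookkeeping carrier for drift statements about a bare
sequence). [folklore] -/
def splitOf (b : ℕ → ℝ) : B12Beta.OneLoopSplit (fun k (_ : Fin (k + 1) → ℝ) => b k) where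
  β0 := b
  β1 := fun _ _ => 0
  split := fun _ _ => by simp
  vanish := fun _ _ _ => rfl

/-- **THE FREE-BUBBLE DRIFT.**  Under the two printed Props BY NAME (h12, h126), base-point labels and window data: the free one-shot bubble at blocking `Lc^n`
satisfies `|oneShotSide (Lc^n) − oneShotSide (Lc^0) − n · stepBal N Lc| ≤ A` for some `A`, all `n` — §7's drift theorem at the TAUTOLOGICAL instance
`β⁰_j := oneShotSide (Lc^(j+1)) − oneShotSide (Lc^j)` (for which `hU` holds with `U := |oneShotSide … 1|`).  No β-family of any construction is involved. [folklore] -/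
theorem oneShotSide_drift (a : ℝ) (ha : 0 < a)
    (h12 : B5.Prop12Printed (fam (fun i : ℕ+ × ℕ => ((i.1 : ℕ+) : ℕ)) (fun i => i.1.pos) MvE a ha))
    (h126 : B5.Kernel126_127Printed (kfam (fun i : ℕ+ × ℕ => ((i.1 : ℕ+) : ℕ)) MvE))
    {SL : Finset L} (hSL : SL.Nonempty) (k : L → Fin 4) {μ ν : Fin 4} (hμν : μ ≠ ν) {N : ℝ} (hN : N ≠ 0) {Lc : ℕ} (hL : 2 ≤ Lc)
    {cc : ℝ} {M : ℕ → ℕ} (hc : 1 ≤ cc) (hM : ∀ L : ℕ, 2 ≤ L → 1 ≤ M L ∧ (L : ℝ) ≤ cc * M L) (hML : ∀ L : ℕ, 2 ≤ L → M L ≤ L) :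
    ∃ A : ℝ, ∀ n : ℕ, |oneShotSide SL μ ν N a k (Lc ^ n) - oneShotSide SL μ ν N a k (Lc ^ 0) - B12Normalization.stepBal N Lc * n| ≤ A := by
  set incr : ℕ → ℝ := fun j => oneShotSide SL μ ν N a k (Lc ^ (j + 1)) - oneShotSide SL μ ν N a k (Lc ^ j) with hincr
  have hsum : ∀ m : ℕ, ∑ j ∈ range m, incr j = oneShotSide SL μ ν N a k (Lc ^ m) - oneShotSide SL μ ν N a k (Lc ^ 0) := fun m =>
    Finset.sum_range_sub (fun j => oneShotSide SL μ ν N a k (Lc ^ j)) m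
  have hU : ∀ m : ℕ, 1 ≤ m → |composedCoeff (fun j _ => incr j) m - oneShotSide SL μ ν N a k (Lc ^ m)| ≤ |oneShotSide SL μ ν N a k (Lc ^ 0)| := by
    intro m _
    rw [composedCoeff_trivial, hsum, show oneShotSide SL μ ν N a k (Lc ^ m) - oneShotSide SL μ ν N a k (Lc ^ 0) - oneShotSide SL μ ν N a k (Lc ^ m)
      = -oneShotSide SL μ ν N a k (Lc ^ 0) by ring, abs_neg]
  obtain ⟨A, hA⟩ := oneLoopDrift_of_vectorTails_evenVolume a ha h12 h126 hSL k (splitOf incr) hμν hN hL (μC := fun j _ => incr j) hc hM hML hU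
    (identityForm_trivial incr)
  refine ⟨A, fun n => ?_⟩
  have h := hA n
  change |∑ j ∈ range n, incr j - B12Normalization.stepBal N Lc * n| ≤ A at h
  rwa [hsum] at h

/-- **`D1Rep ⟺ OneLoopDrift`** (given the scale-wise data).  With hTA/(T0)/(T1), the (1.22) read-out `hβ` and `D1Tel` (so that `Σ_{j<m} β⁰_j = secondMoment (𝒯 m) μ ν`,
`flowSum_eq_oneShotReadout`), and under h12/h126 + labels + window data (for the free-bubble drift): the representation binder `∃ U, ∀ m ≥ 1, |secondMoment (𝒯 m) μ ν −
oneShotSide … (Lc^m)| ≤ U` holds IFF the one-loop coefficients drift, `∃ A, OneLoopDrift (stepBal N Lc) A Sβ.β0`.  (⇒ is §7; ⇐ is the free-bubble drift.) [folklore] -/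
theorem d1Rep_iff_oneLoopDrift (a : ℝ) (ha : 0 < a)
    (h12 : B5.Prop12Printed (fam (fun i : ℕ+ × ℕ => ((i.1 : ℕ+) : ℕ)) (fun i => i.1.pos) MvE a ha))
    (h126 : B5.Kernel126_127Printed (kfam (fun i : ℕ+ × ℕ => ((i.1 : ℕ+) : ℕ)) MvE))
    {SL : Finset L} (hSL : SL.Nonempty) (k : L → Fin 4) {μ ν : Fin 4}
    {β : HBeta} (Sβ : B12Beta.OneLoopSplit β) (hμν : μ ≠ ν) {N : ℝ} (hN : N ≠ 0) {Lc : ℕ} [NeZero Lc] (hL : 2 ≤ Lc)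
    (T 𝒯 : ℕ → EKer 4) (hTA : ∀ j c e, AbsMoment₂ (T j c e)) (hT0 : ∀ j c e, HasSum (T j c e) 0)
    (hT1 : ∀ j c e (ρ : Fin 4), HasSum (fun t : Fin 4 → ℤ => t ρ • T j c e t) 0)
    (hβ : ∀ j, Sβ.β0 j = secondMoment (T j) μ ν) (htel : HessianTelescoping Lc T 𝒯)
    {cc : ℝ} {M : ℕ → ℕ} (hc : 1 ≤ cc) (hM : ∀ L : ℕ, 2 ≤ L → 1 ≤ M L ∧ (L : ℝ) ≤ cc * M L) (hML : ∀ L : ℕ, 2 ≤ L → M L ≤ L) :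
    (∃ U : ℝ, ∀ m : ℕ, 1 ≤ m → |secondMoment (𝒯 m) μ ν - oneShotSide SL μ ν N a k (Lc ^ m)| ≤ U) ↔
      ∃ A : ℝ, OneLoopDrift (B12Normalization.stepBal N Lc) A Sβ.β0 := by
  have hβ' : ∀ j, Sβ.β0 j = readout122 μ ν (m2Tensor (T j)) := fun j => by rw [readout122_m2Tensor]; exact hβ j
  have hflow : ∀ m : ℕ, 1 ≤ m → ∑ j ∈ range m, Sβ.β0 j = secondMoment (𝒯 m) μ ν := fun m hm => by
    rw [flowSum_eq_oneShotReadout hTA hT0 hT1 htel (readout122_add μ ν) hβ' hm, readout122_m2Tensor]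
  constructor
  · rintro ⟨U, hrep⟩
    have hU' : ∀ m : ℕ, 1 ≤ m → |composedCoeff (fun j _ => Sβ.β0 j) m - oneShotSide SL μ ν N a k (Lc ^ m)| ≤ U :=
      hU_of_scalewise hTA hT0 hT1 htel (readout122_add μ ν) hβ' (oneShotFullSum_readout122_iff.mpr hrep)
    exact oneLoopDrift_of_vectorTails_evenVolume a ha h12 h126 hSL k Sβ hμν hN hL (μC := fun j _ => Sβ.β0 j) hc hM hML hU'
      (identityForm_trivial Sβ.β0)
  · rintro ⟨A, hA⟩
    obtain ⟨A', hA'⟩ := oneShotSide_drift a ha h12 h126 hSL k hμν hN hL hc hM hML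
    refine ⟨A + A' + |oneShotSide SL μ ν N a k (Lc ^ 0)|, fun m hm => ?_⟩
    rw [← hflow m hm]
    have h1 := hA m
    have h2 := hA' m
    have e : ∑ j ∈ range m, Sβ.β0 j - oneShotSide SL μ ν N a k (Lc ^ m)
        = (∑ j ∈ range m, Sβ.β0 j - B12Normalization.stepBal N Lc * m)
          - (oneShotSide SL μ ν N a k (Lc ^ m) - oneShotSide SL μ ν N a k (Lc ^ 0) - B12Normalization.stepBal N Lc * m)
          - oneShotSide SL μ ν N a k (Lc ^ 0) := by ring
    rw [e]
    calc |∑ j ∈ range m, Sβ.β0 j - B12Normalization.stepBal N Lc * m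
          - (oneShotSide SL μ ν N a k (Lc ^ m) - oneShotSide SL μ ν N a k (Lc ^ 0) - B12Normalization.stepBal N Lc * m)
          - oneShotSide SL μ ν N a k (Lc ^ 0)|
        ≤ |∑ j ∈ range m, Sβ.β0 j - B12Normalization.stepBal N Lc * m
            - (oneShotSide SL μ ν N a k (Lc ^ m) - oneShotSide SL μ ν N a k (Lc ^ 0) - B12Normalization.stepBal N Lc * m)|
          + |oneShotSide SL μ ν N a k (Lc ^ 0)| := abs_sub _ _
      _ ≤ (A + A') + |oneShotSide SL μ ν N a k (Lc ^ 0)| :=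
          add_le_add ((abs_sub _ _).trans (add_le_add h1 h2)) le_rfl
      _ = A + A' + |oneShotSide SL μ ν N a k (Lc ^ 0)| := by ring

/-- **THE WALL'S ONE-LOOP ITEM WITHOUT LEGS** (END grade): under the scale-wise data the END statement follows from the DRIFT of the one-loop coefficients
`∃ A, OneLoopDrift (stepBal N Lc) A β⁰` + (D4) + (C) alone — an4's `DriftRemainder.endpointExistence_of_drift_remainderConst_cont` re-exported at the socket's
binders, so that EXIT-A may equally be met by proving the drift of `secondMoment (TbalOf Lc Js j) μ ν` by ANY route. [folklore] -/
theorem endpointExistence_of_oneLoopDrift {β : HBeta} {Cn : B12.Construction} (hgen : ForwardGenerated Cn β) (Sβ : B12Beta.OneLoopSplit β)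
    {N : ℝ} {Lc : ℕ} {A rr γ₀ : ℝ} (hγ₀ : 0 < γ₀) (hdrift : OneLoopDrift (B12Normalization.stepBal N Lc) A Sβ.β0)
    (hrem : RemainderConst Sβ γ₀ rr) (hr : rr ≤ B12Normalization.stepBal N Lc) (hcont : BetaContH γ₀ β) : EndpointExistence Cn :=
  DriftRemainder.endpointExistence_of_drift_remainderConst_cont hgen Sβ hγ₀ hdrift hrem hr hcont

end FreeBubbleDrift

/-! ## §10 (v1.7) RULING (R24) BY NAME — WHAT THE CONSTANT `U` OF THE REPRESENTATION BINDER ABSORBS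

an2-g8 asked (X-an2-31) whether `oneShotSide` is tied to the DIRECT one-shot scheme's finite part, so that `D1Rep` for Bałaban's COMPOSITE one-shot kernels would
have to absorb the scheme defect `γ_m` (composite − direct one-loop finite parts at blocking `Lc^m`) inside `U`.  Answer (RULING (R24)): `oneShotSide SL μ ν N a k n`
(§4) is the base-point-averaged full sum of the REALISED FREE table on the explicit `K^∞` kernel `GfE a k n` — a function of `(n, a, N, SL, k)` alone, tied to NO scheme;
and `U` absorbs ANYTHING bounded uniformly in the scale.  This section records the three elementary facts behind that sentence, so that it can be cited by name:
(1) two references drifting with a common slope differ by a bounded amount; hence the free bubble at two admissible parameters `a`, `a′` (h12 at both) stays within a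
bounded distance, and the `D1Rep`-form does not depend on `a`; (2) given ANY second one-shot family `𝒯′` with its own representation, the `D1Rep`-form for `𝒯` holds
IFF the scheme defect `secondMoment (𝒯 m) μ ν − secondMoment (𝒯′ m) μ ν` is bounded in `m` — so a scheme defect is wall content only on a proof route THROUGH the second
scheme, while the wall's statement `D1Drift` (RULING (R23), `d1Rep_iff_oneLoopDrift`) is route-free.  [folklore] bookkeeping (triangle inequalities); nothing printed is
asserted; NOT `BetaPertH`, NOT continuum, NOT Clay. -/

section ReferenceDefect

open Literature.MathematicalPhysics.QuantumFieldTheory.Balaban1983to89.B12Beta (secondMoment)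

/-- **TWO REFERENCES WITH A COMMON SLOPE DIFFER BY A BOUNDED AMOUNT**: if `O₁ n − O₁ 0` and `O₂ n − O₂ 0` both stay within `A₁`, `A₂` of the line `b·n`, then
`|O₁ n − O₂ n| ≤ A₁ + A₂ + |O₁ 0 − O₂ 0|` for every `n`. [folklore] -/
theorem abs_sub_le_of_common_slope {O₁ O₂ : ℕ → ℝ} {b A₁ A₂ : ℝ}
    (h₁ : ∀ n : ℕ, |O₁ n - O₁ 0 - b * n| ≤ A₁) (h₂ : ∀ n : ℕ, |O₂ n - O₂ 0 - b * n| ≤ A₂) (n : ℕ) :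
    |O₁ n - O₂ n| ≤ A₁ + A₂ + |O₁ 0 - O₂ 0| := by
  have e : O₁ n - O₂ n = (O₁ n - O₁ 0 - b * n) - (O₂ n - O₂ 0 - b * n) + (O₁ 0 - O₂ 0) := by ring
  rw [e]
  calc |(O₁ n - O₁ 0 - b * n) - (O₂ n - O₂ 0 - b * n) + (O₁ 0 - O₂ 0)|
      ≤ |(O₁ n - O₁ 0 - b * n) - (O₂ n - O₂ 0 - b * n)| + |O₁ 0 - O₂ 0| := abs_add_le _ _
    _ ≤ (A₁ + A₂) + |O₁ 0 - O₂ 0| := add_le_add ((abs_sub _ _).trans (add_le_add (h₁ n) (h₂ n))) le_rfl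
    _ = A₁ + A₂ + |O₁ 0 - O₂ 0| := by ring

/-- **THE FREE REFERENCE BUBBLE AT TWO ADMISSIBLE PARAMETERS STAYS WITHIN A BOUNDED DISTANCE** (RULING (R24-2a)): under h12 at `a` AND at `a′` (h126, labels and window
data shared), `|oneShotSide … a … (Lc^n) − oneShotSide … a′ … (Lc^n)| ≤ B` for some `B` and all `n` — both drift with the same slope `stepBal N Lc` (`oneShotSide_drift`).
[folklore] -/
theorem oneShotSide_pair_bounded (a : ℝ) (ha : 0 < a) (a' : ℝ) (ha' : 0 < a')
    (h12 : B5.Prop12Printed (fam (fun i : ℕ+ × ℕ => ((i.1 : ℕ+) : ℕ)) (fun i => i.1.pos) MvE a ha))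
    (h12' : B5.Prop12Printed (fam (fun i : ℕ+ × ℕ => ((i.1 : ℕ+) : ℕ)) (fun i => i.1.pos) MvE a' ha'))
    (h126 : B5.Kernel126_127Printed (kfam (fun i : ℕ+ × ℕ => ((i.1 : ℕ+) : ℕ)) MvE))
    {SL : Finset L} (hSL : SL.Nonempty) (k : L → Fin 4) {μ ν : Fin 4} (hμν : μ ≠ ν) {N : ℝ} (hN : N ≠ 0) {Lc : ℕ} (hL : 2 ≤ Lc)
    {cc : ℝ} {M : ℕ → ℕ} (hc : 1 ≤ cc) (hM : ∀ L : ℕ, 2 ≤ L → 1 ≤ M L ∧ (L : ℝ) ≤ cc * M L) (hML : ∀ L : ℕ, 2 ≤ L → M L ≤ L) :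
    ∃ B : ℝ, ∀ n : ℕ, |oneShotSide SL μ ν N a k (Lc ^ n) - oneShotSide SL μ ν N a' k (Lc ^ n)| ≤ B := by
  obtain ⟨A₁, hA₁⟩ := oneShotSide_drift a ha h12 h126 hSL k hμν hN hL hc hM hML
  obtain ⟨A₂, hA₂⟩ := oneShotSide_drift a' ha' h12' h126 hSL k hμν hN hL hc hM hML
  refine ⟨A₁ + A₂ + |oneShotSide SL μ ν N a k (Lc ^ 0) - oneShotSide SL μ ν N a' k (Lc ^ 0)|, fun n => ?_⟩
  exact abs_sub_le_of_common_slope (O₁ := fun n => oneShotSide SL μ ν N a k (Lc ^ n))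
    (O₂ := fun n => oneShotSide SL μ ν N a' k (Lc ^ n)) hA₁ hA₂ n

/-- **`D1Rep`-FORM ⟺ BOUNDED SCHEME DEFECT, GIVEN A SECOND REPRESENTATION** (RULING (R24-2b)).  If a one-shot family `𝒯′` has the representation
`∀ m ≥ 1, |secondMoment (𝒯′ m) μ ν − oneShotSide … (Lc^m)| ≤ U′`, then for ANY family `𝒯` the `D1Rep`-form `∃ U, ∀ m ≥ 1, |secondMoment (𝒯 m) μ ν − oneShotSide … (Lc^m)| ≤ U`
holds IFF the defect `secondMoment (𝒯 m) μ ν − secondMoment (𝒯′ m) μ ν` is bounded over `m ≥ 1`.  (For Bałaban: `𝒯 := TshotOf Lc (JcRec Js)` composite, `𝒯′` the direct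
`Lc^m`-average's kernel — an2's `γ_m`; the defect is wall content only on a route that proves the direct representation first.) [folklore] -/
theorem d1RepForm_iff_defect_bounded {Lc : ℕ} {𝒯 𝒯' : ℕ → EKer 4} {μ ν : Fin 4} {N a : ℝ} {SL : Finset L} {k : L → Fin 4} {U' : ℝ}
    (h' : ∀ m : ℕ, 1 ≤ m → |secondMoment (𝒯' m) μ ν - oneShotSide SL μ ν N a k (Lc ^ m)| ≤ U') :
    (∃ U : ℝ, ∀ m : ℕ, 1 ≤ m → |secondMoment (𝒯 m) μ ν - oneShotSide SL μ ν N a k (Lc ^ m)| ≤ U) ↔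
      ∃ B : ℝ, ∀ m : ℕ, 1 ≤ m → |secondMoment (𝒯 m) μ ν - secondMoment (𝒯' m) μ ν| ≤ B := by
  constructor
  · rintro ⟨U, hU⟩
    exact ⟨U + U', fun m hm => abs_sub_le_of_common_ref (hU m hm) (h' m hm)⟩
  · rintro ⟨B, hB⟩
    refine ⟨B + U', fun m hm => ?_⟩
    have e : secondMoment (𝒯 m) μ ν - oneShotSide SL μ ν N a k (Lc ^ m)
        = (secondMoment (𝒯 m) μ ν - secondMoment (𝒯' m) μ ν) + (secondMoment (𝒯' m) μ ν - oneShotSide SL μ ν N a k (Lc ^ m)) := by ring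
    rw [e]
    exact (abs_add_le _ _).trans (add_le_add (hB m hm) (h' m hm))

/-- **`D1Rep`-FORM TRANSFERS ALONG A BOUNDED DEFECT** (the direction P7 would use on the DIRECT route): the representation for `𝒯′` with constant `U′` and a defect bound
`B` give the representation for `𝒯` with constant `B + U′`. [folklore] -/
theorem d1RepForm_of_reference {Lc : ℕ} {𝒯 𝒯' : ℕ → EKer 4} {μ ν : Fin 4} {N a : ℝ} {SL : Finset L} {k : L → Fin 4} {U' B : ℝ}
    (h' : ∀ m : ℕ, 1 ≤ m → |secondMoment (𝒯' m) μ ν - oneShotSide SL μ ν N a k (Lc ^ m)| ≤ U')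
    (hB : ∀ m : ℕ, 1 ≤ m → |secondMoment (𝒯 m) μ ν - secondMoment (𝒯' m) μ ν| ≤ B) :
    ∀ m : ℕ, 1 ≤ m → |secondMoment (𝒯 m) μ ν - oneShotSide SL μ ν N a k (Lc ^ m)| ≤ B + U' := by
  intro m hm
  have e : secondMoment (𝒯 m) μ ν - oneShotSide SL μ ν N a k (Lc ^ m)
      = (secondMoment (𝒯 m) μ ν - secondMoment (𝒯' m) μ ν) + (secondMoment (𝒯' m) μ ν - oneShotSide SL μ ν N a k (Lc ^ m)) := by ring
  rw [e]
  exact (abs_add_le _ _).trans (add_le_add (hB m hm) (h' m hm))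

/-- **THE `D1Rep`-FORM DOES NOT DEPEND ON THE PARAMETER `a` OF THE REFERENCE BUBBLE** (RULING (R24-2a)): under h12 at `a` and at `a′` (h126, labels, window data shared),
`(∃ U, ∀ m ≥ 1, |secondMoment (𝒯 m) μ ν − oneShotSide … a … (Lc^m)| ≤ U) ↔ (∃ U, ∀ m ≥ 1, |secondMoment (𝒯 m) μ ν − oneShotSide … a′ … (Lc^m)| ≤ U)`. [folklore] -/
theorem d1RepForm_iff_of_param (a : ℝ) (ha : 0 < a) (a' : ℝ) (ha' : 0 < a')
    (h12 : B5.Prop12Printed (fam (fun i : ℕ+ × ℕ => ((i.1 : ℕ+) : ℕ)) (fun i => i.1.pos) MvE a ha))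
    (h12' : B5.Prop12Printed (fam (fun i : ℕ+ × ℕ => ((i.1 : ℕ+) : ℕ)) (fun i => i.1.pos) MvE a' ha'))
    (h126 : B5.Kernel126_127Printed (kfam (fun i : ℕ+ × ℕ => ((i.1 : ℕ+) : ℕ)) MvE))
    {SL : Finset L} (hSL : SL.Nonempty) (k : L → Fin 4) {μ ν : Fin 4} (hμν : μ ≠ ν) {N : ℝ} (hN : N ≠ 0) {Lc : ℕ} (hL : 2 ≤ Lc)
    {cc : ℝ} {M : ℕ → ℕ} (hc : 1 ≤ cc) (hM : ∀ L : ℕ, 2 ≤ L → 1 ≤ M L ∧ (L : ℝ) ≤ cc * M L) (hML : ∀ L : ℕ, 2 ≤ L → M L ≤ L)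
    (𝒯 : ℕ → EKer 4) :
    (∃ U : ℝ, ∀ m : ℕ, 1 ≤ m → |secondMoment (𝒯 m) μ ν - oneShotSide SL μ ν N a k (Lc ^ m)| ≤ U) ↔
      ∃ U : ℝ, ∀ m : ℕ, 1 ≤ m → |secondMoment (𝒯 m) μ ν - oneShotSide SL μ ν N a' k (Lc ^ m)| ≤ U := by
  obtain ⟨B, hB⟩ := oneShotSide_pair_bounded a ha a' ha' h12 h12' h126 hSL k hμν hN hL hc hM hML
  have key : ∀ {a₁ a₂ : ℝ} {B' : ℝ}, (∀ n : ℕ, |oneShotSide SL μ ν N a₁ k (Lc ^ n) - oneShotSide SL μ ν N a₂ k (Lc ^ n)| ≤ B') →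
      (∃ U : ℝ, ∀ m : ℕ, 1 ≤ m → |secondMoment (𝒯 m) μ ν - oneShotSide SL μ ν N a₁ k (Lc ^ m)| ≤ U) →
      ∃ U : ℝ, ∀ m : ℕ, 1 ≤ m → |secondMoment (𝒯 m) μ ν - oneShotSide SL μ ν N a₂ k (Lc ^ m)| ≤ U := by
    intro a₁ a₂ B' hB' h
    obtain ⟨U, hU⟩ := h
    refine ⟨U + B', fun m hm => ?_⟩
    have e : secondMoment (𝒯 m) μ ν - oneShotSide SL μ ν N a₂ k (Lc ^ m)
        = (secondMoment (𝒯 m) μ ν - oneShotSide SL μ ν N a₁ k (Lc ^ m))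
          + (oneShotSide SL μ ν N a₁ k (Lc ^ m) - oneShotSide SL μ ν N a₂ k (Lc ^ m)) := by ring
    rw [e]
    exact (abs_add_le _ _).trans (add_le_add (hU m hm) (hB' m))
  have hB' : ∀ n : ℕ, |oneShotSide SL μ ν N a' k (Lc ^ n) - oneShotSide SL μ ν N a k (Lc ^ n)| ≤ B := fun n => by
    rw [abs_sub_comm]; exact hB n
  exact ⟨key hB, key hB'⟩

end ReferenceDefect

/-! ## §11 (v1.8) THE READ-OUT-LEVEL SEAM — `ReadoutSum`: what the wall consumes of Hessian telescoping, and nothing more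

beta-an4-g16's observation X-an4-38 (journal, CLAIM R1-MOD-REMAINDER): EXIT-B reads the telescoping binder `htel : HessianTelescoping Lc T 𝒯` (all `4⁴`
components of the second-moment tensors) ONLY through `HidentScalewise.flowSum_eq_oneShotReadout` at ONE additive read-out, i.e. only through the identity
`Σ_{j<m} β⁰_j = secondMoment (𝒯 m) μ ν` (`μ ≠ ν`).  RULING (R26-2) made the inter-slice longitudinal cancellation a typed support item (P6c) whose weakest
sufficient level is exactly this read-out.  This section cuts the seam there: `ReadoutSum` is the binder, the v1 socket implies it, and the iff with the drift,
the drift, and the END statement follow from it with NO step-kernel data (the (α)-leaves `h12`/`h126` enter only through the free-bubble drift of §9, as before).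
Bookkeeping only; [folklore]; nothing of Bałaban's is asserted; NOT `BetaPertH`, NOT continuum, NOT Clay. -/

section ReadoutSeam

open Literature.MathematicalPhysics.QuantumFieldTheory.Balaban1983to89.B12Beta (secondMoment)
open Literature.MathematicalPhysics.QuantumFieldTheory.Balaban1983to89.Beta.Drift (OneLoopDrift)

/-- **READ-OUT-LEVEL TELESCOPING**: the partial sums of the step coefficients `β0` ARE the `(μ, ν)` second moments of the one-shot kernels `𝒯 m`, `m ≥ 1`.
For Bałaban's data this is the read-out-level form of (D1-tel) (beta-an4 `HessianTelescopingKKT` v1.3 `flowSum_of_stepRecursionUpTo_wStep` at `F := readout122 μ ν`);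
a predicate, never a fact. [folklore] -/
def ReadoutSum (β0 : ℕ → ℝ) (𝒯 : ℕ → EKer 4) (μ ν : Fin 4) : Prop :=
  ∀ m : ℕ, 1 ≤ m → ∑ j ∈ range m, β0 j = secondMoment (𝒯 m) μ ν

/-- **THE v1 SOCKET IMPLIES THE READ-OUT-LEVEL ONE**: Hessian data of the step kernels (AbsMoment₂, (T0), (T1)), the read-out `hβ` and `HessianTelescoping` give
`ReadoutSum` (`HidentScalewise.flowSum_eq_oneShotReadout` at `F := readout122 μ ν`). [folklore] -/
theorem readoutSum_of_hessianTelescoping {Lc : ℕ} [NeZero Lc] {T 𝒯 : ℕ → EKer 4}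
    (hTA : ∀ j c e, AbsMoment₂ (T j c e)) (hT0 : ∀ j c e, HasSum (T j c e) 0)
    (hT1 : ∀ j c e (ρ : Fin 4), HasSum (fun t : Fin 4 → ℤ => t ρ • T j c e t) 0)
    {β0 : ℕ → ℝ} {μ ν : Fin 4} (hβ : ∀ j, β0 j = secondMoment (T j) μ ν) (htel : HessianTelescoping Lc T 𝒯) :
    ReadoutSum β0 𝒯 μ ν := by
  intro m hm
  have hβ' : ∀ j, β0 j = readout122 μ ν (m2Tensor (T j)) := fun j => by rw [readout122_m2Tensor]; exact hβ j
  rw [flowSum_eq_oneShotReadout hTA hT0 hT1 htel (readout122_add μ ν) hβ' hm, readout122_m2Tensor]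

/-- **`hU` FROM THE READ-OUT-LEVEL TELESCOPING**: `ReadoutSum` + the `D1Rep`-form ⟹ the vector road's full-sum comparison on the partial sums (trivial instance
`μC := fun j _ => β0 j`). [folklore] -/
theorem hU_of_readoutSum {Lc : ℕ} {β0 : ℕ → ℝ} {𝒯 : ℕ → EKer 4} {μ ν : Fin 4} (hRS : ReadoutSum β0 𝒯 μ ν)
    {N a : ℝ} {SL : Finset L} {k : L → Fin 4} {U : ℝ}
    (hrep : ∀ m : ℕ, 1 ≤ m → |secondMoment (𝒯 m) μ ν - oneShotSide SL μ ν N a k (Lc ^ m)| ≤ U) :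
    ∀ m : ℕ, 1 ≤ m → |composedCoeff (fun j _ => β0 j) m - oneShotSide SL μ ν N a k (Lc ^ m)| ≤ U := by
  intro m hm
  rw [composedCoeff_trivial, hRS m hm]
  exact hrep m hm

/-- **AT THE READ-OUT LEVEL, (D1-rep) ⟺ THE DRIFT** — with NO step-kernel data: given `ReadoutSum β⁰ 𝒯 μ ν`, the representation binder
`∃ U, ∀ m ≥ 1, |secondMoment (𝒯 m) μ ν − oneShotSide … (Lc^m)| ≤ U` holds IFF `∃ A, OneLoopDrift (stepBal N Lc) A β⁰` (forward: the vector road of §7; backward: the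
free-bubble drift `oneShotSide_drift` of §9).  `d1Rep_iff_oneLoopDrift` is the special case `ReadoutSum` ⟸ v1 socket. [folklore] -/
theorem readoutRep_iff_oneLoopDrift (a : ℝ) (ha : 0 < a)
    (h12 : B5.Prop12Printed (fam (fun i : ℕ+ × ℕ => ((i.1 : ℕ+) : ℕ)) (fun i => i.1.pos) MvE a ha))
    (h126 : B5.Kernel126_127Printed (kfam (fun i : ℕ+ × ℕ => ((i.1 : ℕ+) : ℕ)) MvE))
    {SL : Finset L} (hSL : SL.Nonempty) (k : L → Fin 4) {μ ν : Fin 4}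
    {β : HBeta} (Sβ : B12Beta.OneLoopSplit β) (hμν : μ ≠ ν) {N : ℝ} (hN : N ≠ 0) {Lc : ℕ} [NeZero Lc] (hL : 2 ≤ Lc)
    (𝒯 : ℕ → EKer 4) (hRS : ReadoutSum Sβ.β0 𝒯 μ ν)
    {cc : ℝ} {M : ℕ → ℕ} (hc : 1 ≤ cc) (hM : ∀ L : ℕ, 2 ≤ L → 1 ≤ M L ∧ (L : ℝ) ≤ cc * M L) (hML : ∀ L : ℕ, 2 ≤ L → M L ≤ L) :
    (∃ U : ℝ, ∀ m : ℕ, 1 ≤ m → |secondMoment (𝒯 m) μ ν - oneShotSide SL μ ν N a k (Lc ^ m)| ≤ U) ↔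
      ∃ A : ℝ, OneLoopDrift (B12Normalization.stepBal N Lc) A Sβ.β0 := by
  constructor
  · rintro ⟨U, hrep⟩
    exact oneLoopDrift_of_vectorTails_evenVolume a ha h12 h126 hSL k Sβ hμν hN hL (μC := fun j _ => Sβ.β0 j) hc hM hML
      (hU_of_readoutSum hRS hrep) (identityForm_trivial Sβ.β0)
  · rintro ⟨A, hA⟩
    obtain ⟨A', hA'⟩ := oneShotSide_drift a ha h12 h126 hSL k hμν hN hL hc hM hML
    refine ⟨A + A' + |oneShotSide SL μ ν N a k (Lc ^ 0)|, fun m hm => ?_⟩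
    rw [← hRS m hm]
    have h1 := hA m
    have h2 := hA' m
    have e : ∑ j ∈ range m, Sβ.β0 j - oneShotSide SL μ ν N a k (Lc ^ m)
        = (∑ j ∈ range m, Sβ.β0 j - B12Normalization.stepBal N Lc * m)
          - (oneShotSide SL μ ν N a k (Lc ^ m) - oneShotSide SL μ ν N a k (Lc ^ 0) - B12Normalization.stepBal N Lc * m)
          - oneShotSide SL μ ν N a k (Lc ^ 0) := by ring
    rw [e]
    calc |∑ j ∈ range m, Sβ.β0 j - B12Normalization.stepBal N Lc * m
          - (oneShotSide SL μ ν N a k (Lc ^ m) - oneShotSide SL μ ν N a k (Lc ^ 0) - B12Normalization.stepBal N Lc * m)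
          - oneShotSide SL μ ν N a k (Lc ^ 0)|
        ≤ |∑ j ∈ range m, Sβ.β0 j - B12Normalization.stepBal N Lc * m
            - (oneShotSide SL μ ν N a k (Lc ^ m) - oneShotSide SL μ ν N a k (Lc ^ 0) - B12Normalization.stepBal N Lc * m)|
          + |oneShotSide SL μ ν N a k (Lc ^ 0)| := abs_sub _ _
      _ ≤ (A + A') + |oneShotSide SL μ ν N a k (Lc ^ 0)| :=
          add_le_add ((abs_sub _ _).trans (add_le_add h1 h2)) le_rfl
      _ = A + A' + |oneShotSide SL μ ν N a k (Lc ^ 0)| := by ring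

/-- **THE DRIFT FROM THE READ-OUT-LEVEL DATA**: `ReadoutSum` + the `D1Rep`-form ⟹ `∃ A, OneLoopDrift (stepBal N Lc) A β⁰`. [folklore] -/
theorem oneLoopDrift_of_readoutSum_rep (a : ℝ) (ha : 0 < a)
    (h12 : B5.Prop12Printed (fam (fun i : ℕ+ × ℕ => ((i.1 : ℕ+) : ℕ)) (fun i => i.1.pos) MvE a ha))
    (h126 : B5.Kernel126_127Printed (kfam (fun i : ℕ+ × ℕ => ((i.1 : ℕ+) : ℕ)) MvE))
    {SL : Finset L} (hSL : SL.Nonempty) (k : L → Fin 4) {μ ν : Fin 4}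
    {β : HBeta} (Sβ : B12Beta.OneLoopSplit β) (hμν : μ ≠ ν) {N : ℝ} (hN : N ≠ 0) {Lc : ℕ} [NeZero Lc] (hL : 2 ≤ Lc)
    (𝒯 : ℕ → EKer 4) (hRS : ReadoutSum Sβ.β0 𝒯 μ ν)
    {U cc : ℝ} {M : ℕ → ℕ} (hc : 1 ≤ cc) (hM : ∀ L : ℕ, 2 ≤ L → 1 ≤ M L ∧ (L : ℝ) ≤ cc * M L) (hML : ∀ L : ℕ, 2 ≤ L → M L ≤ L)
    (hrep : ∀ m : ℕ, 1 ≤ m → |secondMoment (𝒯 m) μ ν - oneShotSide SL μ ν N a k (Lc ^ m)| ≤ U) :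
    ∃ A : ℝ, OneLoopDrift (B12Normalization.stepBal N Lc) A Sβ.β0 :=
  (readoutRep_iff_oneLoopDrift a ha h12 h126 hSL k Sβ hμν hN hL 𝒯 hRS hc hM hML).1 ⟨U, hrep⟩

/-- **THE WALL THROUGH THE READ-OUT-LEVEL SEAM, (D4) CONSTANT FORM + (C) ONLY**: `ReadoutSum` + `D1Rep`-form + the two printed Props BY NAME + labels/window ⟹
the drift ⟹ `EndpointExistence` by `endpointExistence_of_oneLoopDrift` (an4's `DriftRemainder.endpointExistence_of_drift_remainderConst_cont`).  «END statement modulo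
{h12, h126 by name, read-out telescoping, the one-shot representation, (D4), (C)}» — no step-kernel data in the socket. [folklore] -/
theorem endpointExistence_of_readoutSum_rep_cont (a : ℝ) (ha : 0 < a)
    (h12 : B5.Prop12Printed (fam (fun i : ℕ+ × ℕ => ((i.1 : ℕ+) : ℕ)) (fun i => i.1.pos) MvE a ha))
    (h126 : B5.Kernel126_127Printed (kfam (fun i : ℕ+ × ℕ => ((i.1 : ℕ+) : ℕ)) MvE))
    {SL : Finset L} (hSL : SL.Nonempty) (k : L → Fin 4) {μ ν : Fin 4}
    {β : HBeta} {Cn : B12.Construction} (hgen : ForwardGenerated Cn β)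
    (Sβ : B12Beta.OneLoopSplit β) (hμν : μ ≠ ν) {N : ℝ} (hN : N ≠ 0) {Lc : ℕ} [NeZero Lc] (hL : 2 ≤ Lc)
    (𝒯 : ℕ → EKer 4) (hRS : ReadoutSum Sβ.β0 𝒯 μ ν)
    {U cc : ℝ} {M : ℕ → ℕ} (hc : 1 ≤ cc) (hM : ∀ L : ℕ, 2 ≤ L → 1 ≤ M L ∧ (L : ℝ) ≤ cc * M L) (hML : ∀ L : ℕ, 2 ≤ L → M L ≤ L)
    (hrep : ∀ m : ℕ, 1 ≤ m → |secondMoment (𝒯 m) μ ν - oneShotSide SL μ ν N a k (Lc ^ m)| ≤ U)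
    {rr γ₀ : ℝ} (hγ₀ : 0 < γ₀) (hrem : RemainderConst Sβ γ₀ rr) (hr : rr ≤ B12Normalization.stepBal N Lc)
    (hcont : BetaContH γ₀ β) : EndpointExistence Cn := by
  obtain ⟨A, hA⟩ := oneLoopDrift_of_readoutSum_rep a ha h12 h126 hSL k Sβ hμν hN hL 𝒯 hRS hc hM hML hrep
  exact endpointExistence_of_oneLoopDrift hgen Sβ hγ₀ hA hrem hr hcont

end ReadoutSeam

end Literature.MathematicalPhysics.QuantumFieldTheory.Balaban1983to89.Beta.ScalewiseVectorSeam
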